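import Literature.Analysis.FluidPDE.OnsagerBDSVCorrectorBounds
import Literature.Analysis.FluidPDE.OnsagerBDSVCorrectorCurl
import Literature.Analysis.FluidPDE.OnsagerBDSVEnvelope
import Literature.Analysis.FluidPDE.OnsagerBDSVTransportEstimates
import Literature.Analysis.FluidPDE.OnsagerBDSVGluingProofs
import Literature.Analysis.FluidPDE.OnsagerBDSVEnergyCorrector
import Literature.Analysis.FluidPDE.OnsagerBDSVEnergyCorrectorHolds
import Literature.Analysis.FluidPDE.OnsagerBDSVDeformationBoundsTildeR
import HarnessLib

/-!
# The BDSV perturbation: proof of Cor. 5.8 (5.30) — the bounds on the corrector `w_c`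

Buckmaster–De Lellis–Székelyhidi–Vicol (BDSV), *Onsager's conjecture for admissible weak
solutions*, CPAM 72 (2019) = arXiv:1701.08678, Cor. 5.8, arXiv (5.30):
"`‖w_c‖₀ + λ_{q+1}⁻¹‖w_c‖₁ ≲ δ_{q+1}^{1/2} ℓ⁻¹ λ_{q+1}^{-1}`" (printed with the misprint `λ_{q+1}^{N-1}`),
whose two-line proof is "a direct consequence of (5.26) [`‖c_{i,k}‖_N ≲ δ_{q+1}^{1/2}λ_{q+1}⁻¹|k|⁻⁶ℓ^{-N-1}`]
and (5.34) [`‖∇e^{iλ_{q+1}k·Φᵢ}‖₀ ≤ 2λ_{q+1}|k|`]". This file PROVES the tree's named fact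
`BDSV.correctorPartBound` (`OnsagerBDSVCorrectorBounds.lean`): `theorem correctorPartBound_holds`.

The tree has no Fourier decomposition of the Mikado potential; the role of the amplitudes `c_{i,k}`
is played by the SLOW PART of the derivative of the lifted potential summand
(`BDSV.slowDeriv`/`BDSV.slowPart`, `OnsagerBDSVCorrectorCurl.lean`), through the identity
`w_c = n⁻¹ ∑ᵢ curl[slowPartᵢ]` (`BDSV.correctorPart_proj`, the tree's (5.27)). The proof:

* `BDSV.hasEnvelope_slowDeriv` — the two-scale structure of (5.26)/(5.30) as an order-one
  frequency envelope (`BDSV.HasEnvelope`, `OnsagerBDSVEnvelope.lean`): if the slow factors `ηᵢ`,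
  `∇Φᵢ`, `R̃_{q,i}` have size `O(1)` and derivatives `O(μ_slow)` while the Mikado composite
  `V(R̃, n(y + D))` costs `μ ∼ λ_{q+1}` per derivative, then `‖slowDeriv‖ ≤ A`,
  `‖D slowDeriv‖ ≤ 2Aμ` with `A = σ‖T‖C_V(16A_S + 4A_D + 8A_η)` — Leibniz through the bilinear
  maps `compL`, `flip`, `apply`, `smulRightL` (nested operator spaces over `ℝ³` need
  `maxSynthPendingDepth 3`);
* `BDSV.lift_correctorPart_eq`, `BDSV.norm_correctorPart_le_of_slowPart`,
  `BDSV.norm_partialDeriv_correctorPart_le_of_slowPart` — `w_c` and `∂ⱼw_c` through the slow parts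
  (`∂ⱼ w_c = n⁻¹∑ᵢ curl[D slowPartᵢ · eⱼ]`);
* the pointwise inputs under `BDSV.PerturbationHypotheses` (`N̄ = 2`): (2.19)–(2.20) for the lifts,
  Lemma 5.3 for `ηᵢ`, Lemma 5.4 ((5.15)–(5.16), (5.19)) for `σ = (ρ_q/∑∫η_j²)^{1/2}` and
  `c = ∑∫η_j²/ρ_q`, App. B (B.4)–(B.5) for `Dᵢ = Φᵢ - id` localised by property (iv)
  (`PerturbationData.norm_iteratedFDeriv_lift_D_le`: `‖D(lift Dᵢ)‖ ≤ 1/600`, `‖D²‖ ≤ ℓ⁻¹`,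
  `‖D³‖ ≤ 2ℓ⁻²` once `C_inℓ^{2α} ≤ 1/2400`), the normalised stress
  (`PerturbationData.abs_c_mul_norm_iteratedFDeriv_lift_Rbar_le`, the "crude estimate" of Prop. 5.7),
  whence `PerturbationData.hasEnvelope_slowPart`: `slowPartᵢ(t)` has envelope
  `(corrAmp · δ_{q+1}^{1/2}ℓ⁻¹, 2·corrFreq·n_{q+1})` on `supp_t ηᵢ` (using (6.6) `ℓ⁻¹ ≤ λ_{q+1}`);
* `BDSV.CutoffFamily.sum_le_two_mul` — at most two cut-offs are active at a time (property (iv));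
* `BDSV.correctorPartBound_holds` — assembly along `BDSV.StageFact` with
  `α₀ = min(βb(b-1), (1-β)(b-1)/3)`, `N̄ = 2`, `C = 4π‖curl‖·corrAmp·corrFreq` and `a₀` beyond the
  thresholds of `4δ_{q+2} ≤ δ_{q+1}λ_q^{-α}`, `C_inℓ^{2α} ≤ 1/2400`, `8‖ofCols‖C_inλ_q^αℓ^α ≤ 1`,
  `8C_inλ_q^αℓ^α ≤ 1/100` and (6.6); `λ_{q+1} = 2πn_{q+1}`.

## References

* T. Buckmaster, C. De Lellis, L. Székelyhidi Jr., V. Vicol, *Onsager's conjecture for admissible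
  weak solutions*, Comm. Pure Appl. Math. 72 (2019) 229–274 = arXiv:1701.08678: §5.3 (5.20),
  (5.27)–(5.28); §5.5 Prop. 5.7 (arXiv (5.23)–(5.26)) and its proof ((5.32)–(5.33)), Cor. 5.8
  (arXiv (5.29)–(5.31)) and its proof ((5.34)–(5.36)); Lemma 5.3; Lemma 5.4 ((5.14)–(5.16), (5.19));
  §6.1.1 (6.6); App. B Prop. B.1 (B.4)–(B.5). Equation numbers as in arXiv:1701.08678v1.
-/

open MeasureTheory Set
open scoped NNReal ENNReal ContDiff Matrix Matrix.Norms.Elementwise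

noncomputable section

namespace Literature.Analysis.FluidPDE

namespace BDSV

open FunctionSpaces FunctionSpaces.Torus

-- nested spaces of continuous linear maps over `EuclideanSpace ℝ (Fin 3)` need deeper
-- instance synthesis during unification (operator norms on `(ℝ³ →L 𝕃) →L (ℝ³ →L 𝕃)` etc.)
set_option maxSynthPendingDepth 3

/-- The flat three-torus `T³ = (ℝ/ℤ)³`, local notation. -/
local notation "𝕋³" => UnitAddTorus (Fin 3)

/-- Euclidean `ℝ³`, local notation. -/
local notation "ℝ³" => EuclideanSpace ℝ (Fin 3)

/-- Real `3 × 3` matrices, local notation. -/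
local notation "𝕄" => Matrix (Fin 3) (Fin 3) ℝ

/-- Continuous linear endomorphisms of `ℝ³`, local notation. -/
local notation "𝕃" => (EuclideanSpace ℝ (Fin 3) →L[ℝ] EuclideanSpace ℝ (Fin 3))


/-! ## Envelope helpers -/

section EnvelopeHelpers

variable {E F : Type*} [NormedAddCommGroup E] [NormedSpace ℝ E] [NormedAddCommGroup F]
  [NormedSpace ℝ F]

/-- An order-one envelope from a bound on the function and one on its first derivative. [folklore] -/
theorem HasEnvelope.of_le_one {f : E → F} {A μ : ℝ} (hf : ContDiff ℝ ∞ f) (hA : 0 ≤ A) (hμ : 1 ≤ μ)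
    (h0 : ∀ x, ‖f x‖ ≤ A) (h1 : ∀ x, ‖iteratedFDeriv ℝ 1 f x‖ ≤ A * μ) : HasEnvelope f 1 A μ := by
  refine ⟨hf, hA, hμ, fun i hi x => ?_⟩
  rcases Nat.le_one_iff_eq_zero_or_eq_one.1 hi with rfl | rfl
  · rw [norm_iteratedFDeriv_zero, pow_zero, mul_one]; exact h0 x
  · rw [pow_one]; exact h1 x

/-- An order-one envelope for the derivative `Df` from bounds on `Df` and `D²f`. [folklore] -/
theorem HasEnvelope.fderiv_of_le {f : E → F} {A μ : ℝ} (hf : ContDiff ℝ ∞ f) (hA : 0 ≤ A) (hμ : 1 ≤ μ)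
    (h1 : ∀ x, ‖iteratedFDeriv ℝ 1 f x‖ ≤ A) (h2 : ∀ x, ‖iteratedFDeriv ℝ 2 f x‖ ≤ A * μ) :
    HasEnvelope (fderiv ℝ f) 1 A μ := by
  refine HasEnvelope.of_le_one (hf.fderiv_right le_rfl) hA hμ (fun x => ?_) (fun x => ?_)
  · rw [← norm_iteratedFDeriv_one_eq_norm_fderiv]; exact h1 x
  · rw [norm_iteratedFDeriv_fderiv]; exact h2 x

end EnvelopeHelpers

/-! ## The order-one envelope of the slow part -/

section SlowEnvelope

variable {V : 𝕄 → 𝕋³ → ℝ³} {σ c n : ℝ} {ηsl : 𝕋³ → ℝ} {Rsl : 𝕋³ → Fin 3 → ℝ³} {Dsl : 𝕋³ → ℝ³}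

/-- The flip isometry of `ℝ³ →L (ℝ³ →L ℝ³)` has norm at most one as a continuous linear map.
[folklore] -/
theorem norm_flipCL_le :
    ‖((ContinuousLinearMap.flipₗᵢ ℝ ℝ³ ℝ³ ℝ³).toLinearIsometry.toContinuousLinearMap)‖ ≤ 1 :=
  (ContinuousLinearMap.flipₗᵢ ℝ ℝ³ ℝ³ ℝ³).toLinearIsometry.norm_toContinuousLinearMap_le

/-- `‖apply‖ ≤ 1` for the evaluation map `(v, L) ↦ L v`. [folklore] -/
theorem norm_apply_le : ‖ContinuousLinearMap.apply ℝ ℝ³ (E := ℝ³)‖ ≤ 1 := by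
  rw [ContinuousLinearMap.apply, ContinuousLinearMap.opNorm_flip]
  exact ContinuousLinearMap.norm_id_le

/-- `∇Φ = Id + D(lift D)` has the order-one envelope `(2, μ)` when `‖D(lift D)‖ ≤ 1` and
`‖D²(lift D)‖ ≤ 2μ`. [folklore] -/
theorem hasEnvelope_gradPhiCL (hD : IsSmooth Dsl) {μ : ℝ} (hμ : 1 ≤ μ)
    (hd1 : ∀ y, ‖iteratedFDeriv ℝ 1 (lift Dsl) y‖ ≤ 1) (hd2 : ∀ y, ‖iteratedFDeriv ℝ 2 (lift Dsl) y‖ ≤ 2 * μ) :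
    HasEnvelope (gradPhiCL Dsl) 1 2 μ := by
  refine HasEnvelope.of_le_one (contDiff_gradPhiCL hD) (by norm_num) hμ (fun y => ?_) (fun y => ?_)
  · exact (norm_gradPhiCL_le Dsl y).trans (by linarith [hd1 y])
  · rw [norm_iteratedFDeriv_gradPhiCL hD one_ne_zero]; exact hd2 y

/-- `y ↦ T ∘ D²(lift D)(y)` (`T = transposeCL`) has the order-one envelope `(‖T‖ A_D, μ)` when
`‖D²(lift D)‖ ≤ A_D` and `‖D³(lift D)‖ ≤ A_D μ`. [folklore] -/
theorem hasEnvelope_transposeCL_comp_fderiv_fderiv (hD : IsSmooth Dsl) {μ AD : ℝ} (hμ : 1 ≤ μ) (hAD0 : 0 ≤ AD)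
    (hd2 : ∀ y, ‖iteratedFDeriv ℝ 2 (lift Dsl) y‖ ≤ AD) (hd3 : ∀ y, ‖iteratedFDeriv ℝ 3 (lift Dsl) y‖ ≤ AD * μ) :
    HasEnvelope (fun y => transposeCL.comp (fderiv ℝ (fderiv ℝ (lift Dsl)) y)) 1 (‖transposeCL‖ * AD) μ := by
  have hD' : ContDiff ℝ ∞ (lift Dsl) := hD
  have hF₀ : HasEnvelope (fderiv ℝ (fderiv ℝ (lift Dsl))) 1 AD μ := by
    refine HasEnvelope.of_le_one ((hD'.fderiv_right le_rfl).fderiv_right le_rfl) hAD0 hμ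
      (fun y => ?_) (fun y => ?_)
    · rw [← norm_iteratedFDeriv_two_eq_norm_fderiv_fderiv]; exact hd2 y
    · rw [norm_iteratedFDeriv_fderiv, norm_iteratedFDeriv_fderiv]; exact hd3 y
  have h := hF₀.clm_comp (ContinuousLinearMap.compL ℝ ℝ³ 𝕃 𝕃 transposeCL)
  refine h.mono le_rfl (mul_le_mul_of_nonneg_right ?_ hAD0)
  calc ‖ContinuousLinearMap.compL ℝ ℝ³ 𝕃 𝕃 transposeCL‖
      ≤ ‖ContinuousLinearMap.compL ℝ ℝ³ 𝕃 𝕃‖ * ‖transposeCL‖ := ContinuousLinearMap.le_opNorm _ _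
    _ ≤ 1 * ‖transposeCL‖ :=
        mul_le_mul_of_nonneg_right (ContinuousLinearMap.norm_compL_le _ _ _ _) (norm_nonneg _)
    _ = ‖transposeCL‖ := one_mul _

/-- The derivative of the pair `p = (R̃, n(y + D(y)))` is at most `2μ` when `‖DR̃‖ ≤ 2μ`,
`|n| ≤ μ` and `‖D(lift D)‖ ≤ 1` (`Dp = (DR̃, n∇Φ)`, `‖∇Φ‖ ≤ 2`). [folklore] -/
theorem norm_fderiv_pairCL_le (hR : IsSmooth Rsl) (hD : IsSmooth Dsl) {μ : ℝ} (hn : |n| ≤ μ)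
    (hd1 : ∀ y, ‖iteratedFDeriv ℝ 1 (lift Dsl) y‖ ≤ 1)
    (hr1 : ∀ y, ‖iteratedFDeriv ℝ 1 (stressCL c Rsl Dsl) y‖ ≤ 2 * μ) (y : ℝ³) :
    ‖fderiv ℝ (fun z : ℝ³ => (stressCL c Rsl Dsl z, n • (z + lift Dsl z))) y‖ ≤ 2 * μ := by
  have hTs : ContDiff ℝ ∞ (stressCL c Rsl Dsl) := contDiff_stressCL c hR hD
  have hT : HasFDerivAt (stressCL c Rsl Dsl) (fderiv ℝ (stressCL c Rsl Dsl) y) y :=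
    ((hTs.differentiable (by simp)) y).hasFDerivAt
  have hξ := hasFDerivAt_phase (n := n) hD y
  rw [(hT.prodMk hξ).fderiv, ContinuousLinearMap.opNorm_prod, Prod.norm_mk]
  refine max_le ?_ ?_
  · rw [← norm_iteratedFDeriv_one_eq_norm_fderiv]; exact hr1 y
  · rw [norm_smul, Real.norm_eq_abs]
    have hG2 : ‖gradPhiCL Dsl y‖ ≤ 2 := (norm_gradPhiCL_le Dsl y).trans (by linarith [hd1 y])
    have hn0 : 0 ≤ |n| := abs_nonneg n
    nlinarith [norm_nonneg (gradPhiCL Dsl y)]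

/-- **The Mikado composite `V ∘ p` to order one**: `‖V(p)‖ ≤ C_V`, `‖D(V ∘ p)‖ ≤ C_V ‖Dp‖ ≤ 2 C_V μ`
(one fast derivative). [cite: BuckmasterEtAl2018, Cor. 5.8 (5.34)] -/
theorem hasEnvelope_mikadoLiftCL_comp (hV : ContDiff ℝ ∞ (mikadoLift V)) {K : Set 𝕃} {CV : ℝ} (hCV0 : 0 ≤ CV)
    (hCV : ∀ m ≤ 2, ∀ S ∈ K, ∀ ξ : ℝ³, ‖iteratedFDeriv ℝ m (mikadoLiftCL V) (S, ξ)‖ ≤ CV)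
    (hR : IsSmooth Rsl) (hD : IsSmooth Dsl) {μ : ℝ} (hμ : 1 ≤ 2 * μ) (hK : ∀ y, stressCL c Rsl Dsl y ∈ K)
    (hDp : ∀ y, ‖fderiv ℝ (fun z : ℝ³ => (stressCL c Rsl Dsl z, n • (z + lift Dsl z))) y‖ ≤ 2 * μ) :
    HasEnvelope (fun y : ℝ³ => mikadoLiftCL V (stressCL c Rsl Dsl y, n • (y + lift Dsl y))) 1 CV (2 * μ) := by
  have hps : ContDiff ℝ ∞ (fun z : ℝ³ => (stressCL c Rsl Dsl z, n • (z + lift Dsl z))) :=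
    contDiff_pairCL (c := c) (n := n) hR hD
  have hVs := contDiff_mikadoLiftCL hV
  refine HasEnvelope.of_le_one (hVs.comp hps) hCV0 hμ (fun y => ?_) (fun y => ?_)
  · have := hCV 0 (by norm_num) _ (hK y) (n • (y + lift Dsl y))
    rwa [norm_iteratedFDeriv_zero] at this
  · have hM : HasFDerivAt (mikadoLiftCL V)
        (fderiv ℝ (mikadoLiftCL V) (stressCL c Rsl Dsl y, n • (y + lift Dsl y)))
        (stressCL c Rsl Dsl y, n • (y + lift Dsl y)) :=
      ((hVs.differentiable (by simp)) _).hasFDerivAt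
    have hfd : fderiv ℝ (fun z : ℝ³ => mikadoLiftCL V (stressCL c Rsl Dsl z, n • (z + lift Dsl z))) y =
        (fderiv ℝ (mikadoLiftCL V) (stressCL c Rsl Dsl y, n • (y + lift Dsl y))).comp
          (fderiv ℝ (fun z : ℝ³ => (stressCL c Rsl Dsl z, n • (z + lift Dsl z))) y) :=
      (HasFDerivAt.fderiv (hM.comp y ((hps.differentiable (by simp)) y).hasFDerivAt) :)
    rw [norm_iteratedFDeriv_one_eq_norm_fderiv, hfd]
    refine (ContinuousLinearMap.opNorm_comp_le _ _).trans (mul_le_mul ?_ (hDp y) (norm_nonneg _) hCV0)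
    rw [← norm_iteratedFDeriv_one_eq_norm_fderiv]
    exact hCV 1 (by norm_num) _ (hK y) _

/-- **The derivative of the Mikado profile along `p` to order one**: `‖DV(p)‖ ≤ C_V`,
`‖D(DV ∘ p)‖ ≤ 2 C_V μ`. [cite: BuckmasterEtAl2018, Cor. 5.8 (5.34)] -/
theorem hasEnvelope_fderiv_mikadoLiftCL_comp (hV : ContDiff ℝ ∞ (mikadoLift V)) {K : Set 𝕃} {CV : ℝ}
    (hCV0 : 0 ≤ CV) (hCV : ∀ m ≤ 2, ∀ S ∈ K, ∀ ξ : ℝ³, ‖iteratedFDeriv ℝ m (mikadoLiftCL V) (S, ξ)‖ ≤ CV)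
    (hR : IsSmooth Rsl) (hD : IsSmooth Dsl) {μ : ℝ} (hμ : 1 ≤ 2 * μ) (hK : ∀ y, stressCL c Rsl Dsl y ∈ K)
    (hDp : ∀ y, ‖fderiv ℝ (fun z : ℝ³ => (stressCL c Rsl Dsl z, n • (z + lift Dsl z))) y‖ ≤ 2 * μ) :
    HasEnvelope (fun y : ℝ³ => fderiv ℝ (mikadoLiftCL V) (stressCL c Rsl Dsl y, n • (y + lift Dsl y))) 1 CV
      (2 * μ) := by
  have hps : ContDiff ℝ ∞ (fun z : ℝ³ => (stressCL c Rsl Dsl z, n • (z + lift Dsl z))) :=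
    contDiff_pairCL (c := c) (n := n) hR hD
  have hVs' : ContDiff ℝ ∞ (fderiv ℝ (mikadoLiftCL V)) := (contDiff_mikadoLiftCL hV).fderiv_right le_rfl
  refine HasEnvelope.of_le_one (hVs'.comp hps) hCV0 hμ (fun y => ?_) (fun y => ?_)
  · change ‖fderiv ℝ (mikadoLiftCL V) (stressCL c Rsl Dsl y, n • (y + lift Dsl y))‖ ≤ CV
    rw [← norm_iteratedFDeriv_one_eq_norm_fderiv]
    exact hCV 1 (by norm_num) _ (hK y) _
  · have hM : HasFDerivAt (fderiv ℝ (mikadoLiftCL V))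
        (fderiv ℝ (fderiv ℝ (mikadoLiftCL V)) (stressCL c Rsl Dsl y, n • (y + lift Dsl y)))
        (stressCL c Rsl Dsl y, n • (y + lift Dsl y)) :=
      ((hVs'.differentiable (by simp)) _).hasFDerivAt
    have hfd : fderiv ℝ (fun z : ℝ³ => fderiv ℝ (mikadoLiftCL V) (stressCL c Rsl Dsl z, n • (z + lift Dsl z))) y =
        (fderiv ℝ (fderiv ℝ (mikadoLiftCL V)) (stressCL c Rsl Dsl y, n • (y + lift Dsl y))).comp
          (fderiv ℝ (fun z : ℝ³ => (stressCL c Rsl Dsl z, n • (z + lift Dsl z))) y) :=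
      (HasFDerivAt.fderiv (hM.comp y ((hps.differentiable (by simp)) y).hasFDerivAt) :)
    rw [norm_iteratedFDeriv_one_eq_norm_fderiv, hfd]
    refine (ContinuousLinearMap.opNorm_comp_le _ _).trans (mul_le_mul ?_ (hDp y) (norm_nonneg _) hCV0)
    rw [← norm_iteratedFDeriv_two_eq_norm_fderiv_fderiv]
    exact hCV 2 le_rfl _ (hK y) _

/-- `y ↦ inl ∘ DR̃(y)` has the order-one envelope `(A_S, μ)` when `‖DR̃‖ ≤ A_S`, `‖D²R̃‖ ≤ A_S μ`.
[folklore] -/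
theorem hasEnvelope_inl_comp_fderiv_stressCL (hR : IsSmooth Rsl) (hD : IsSmooth Dsl) {μ AS : ℝ} (hμ : 1 ≤ μ)
    (hAS0 : 0 ≤ AS) (hr1 : ∀ y, ‖iteratedFDeriv ℝ 1 (stressCL c Rsl Dsl) y‖ ≤ AS)
    (hr2 : ∀ y, ‖iteratedFDeriv ℝ 2 (stressCL c Rsl Dsl) y‖ ≤ AS * μ) :
    HasEnvelope (fun y => (ContinuousLinearMap.inl ℝ 𝕃 ℝ³).comp (fderiv ℝ (stressCL c Rsl Dsl) y)) 1 AS μ := by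
  have hX₀ : HasEnvelope (fderiv ℝ (stressCL c Rsl Dsl)) 1 AS μ :=
    HasEnvelope.fderiv_of_le (contDiff_stressCL c hR hD) hAS0 hμ hr1 hr2
  have h := hX₀.clm_comp (ContinuousLinearMap.compL ℝ ℝ³ 𝕃 (𝕃 × ℝ³) (ContinuousLinearMap.inl ℝ 𝕃 ℝ³))
  refine h.mono le_rfl ((mul_le_mul_of_nonneg_right ?_ hAS0).trans (le_of_eq (one_mul AS)))
  calc ‖ContinuousLinearMap.compL ℝ ℝ³ 𝕃 (𝕃 × ℝ³) (ContinuousLinearMap.inl ℝ 𝕃 ℝ³)‖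
      ≤ ‖ContinuousLinearMap.compL ℝ ℝ³ 𝕃 (𝕃 × ℝ³)‖ * ‖ContinuousLinearMap.inl ℝ 𝕃 ℝ³‖ :=
        ContinuousLinearMap.le_opNorm _ _
    _ ≤ 1 * 1 := mul_le_mul (ContinuousLinearMap.norm_compL_le _ _ _ _)
        (ContinuousLinearMap.norm_inl_le_one ℝ 𝕃 ℝ³) (norm_nonneg _) zero_le_one
    _ = 1 := one_mul 1

/-- **The slow part has an order-one envelope of slow amplitude.** With `T = transposeCL`: if
`‖DᵐV‖ ≤ C_V` on `K × ℝ³` (`m ≤ 2`), and at every point `|η| ≤ 1`, `‖Dη‖ ≤ A_η`, `‖D²η‖ ≤ A_η μ`,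
`‖D(lift D)‖ ≤ 1`, `‖D²(lift D)‖ ≤ A_D`, `‖D³(lift D)‖ ≤ A_D μ`, `R̃ ∈ K`, `‖DR̃‖ ≤ A_S`,
`‖D²R̃‖ ≤ A_S μ`, where `A_η, A_D, A_S ≤ μ`, `|n| ≤ μ`, `1 ≤ μ`, then the slow part of the
derivative of the lifted potential summand satisfies `‖slowDeriv‖ ≤ A`, `‖D slowDeriv‖ ≤ 2Aμ` with
`A = σ ‖T‖ C_V (16 A_S + 4 A_D + 8 A_η)` (the two-scale structure of (5.26)/(5.30): slow amplitude
`∼ δ^{1/2} ℓ⁻¹`, one fast derivative `∼ λ_{q+1}`).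
[cite: BuckmasterEtAl2018, Prop. 5.7 (5.26) and Cor. 5.8 (5.30)] -/
theorem hasEnvelope_slowDeriv (hV : ContDiff ℝ ∞ (mikadoLift V)) {K : Set 𝕃} {CV : ℝ} (hCV0 : 0 ≤ CV)
    (hCV : ∀ m ≤ 2, ∀ S ∈ K, ∀ ξ : ℝ³, ‖iteratedFDeriv ℝ m (mikadoLiftCL V) (S, ξ)‖ ≤ CV)
    (hσ : 0 ≤ σ) {μ Aη AD AS : ℝ} (hμ : 1 ≤ μ) (hn : |n| ≤ μ) (hAη0 : 0 ≤ Aη) (hAημ : Aη ≤ μ)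
    (hAD0 : 0 ≤ AD) (hADμ : AD ≤ μ) (hAS0 : 0 ≤ AS) (hASμ : AS ≤ μ)
    (hη : IsSmooth ηsl) (hR : IsSmooth Rsl) (hD : IsSmooth Dsl)
    (he0 : ∀ y, |lift ηsl y| ≤ 1) (he1 : ∀ y, ‖iteratedFDeriv ℝ 1 (lift ηsl) y‖ ≤ Aη)
    (he2 : ∀ y, ‖iteratedFDeriv ℝ 2 (lift ηsl) y‖ ≤ Aη * μ)
    (hd1 : ∀ y, ‖iteratedFDeriv ℝ 1 (lift Dsl) y‖ ≤ 1) (hd2 : ∀ y, ‖iteratedFDeriv ℝ 2 (lift Dsl) y‖ ≤ AD)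
    (hd3 : ∀ y, ‖iteratedFDeriv ℝ 3 (lift Dsl) y‖ ≤ AD * μ)
    (hK : ∀ y, stressCL c Rsl Dsl y ∈ K)
    (hr1 : ∀ y, ‖iteratedFDeriv ℝ 1 (stressCL c Rsl Dsl) y‖ ≤ AS)
    (hr2 : ∀ y, ‖iteratedFDeriv ℝ 2 (stressCL c Rsl Dsl) y‖ ≤ AS * μ) :
    HasEnvelope (slowDeriv V σ c n ηsl Rsl Dsl) 1
      (σ * ‖transposeCL‖ * CV * (16 * AS + 4 * AD + 8 * Aη)) (2 * μ) := by
  have hη' : ContDiff ℝ ∞ (lift ηsl) := hη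
  have hμ2 : μ ≤ 2 * μ := by linarith
  have h2μ : 1 ≤ 2 * μ := hμ.trans hμ2
  have hθ : 0 ≤ ‖transposeCL‖ := norm_nonneg transposeCL
  -- the ingredients
  have hG : HasEnvelope (gradPhiCL Dsl) 1 2 μ :=
    hasEnvelope_gradPhiCL hD hμ hd1 fun y => (hd2 y).trans (hADμ.trans hμ2)
  have hAT : HasEnvelope (fun y => transposeCL (gradPhiCL Dsl y)) 1 (‖transposeCL‖ * 2) (2 * μ) :=
    (hG.clm_comp transposeCL).of_mu_le hμ2
  have hF : HasEnvelope (fun y => transposeCL.comp (fderiv ℝ (fderiv ℝ (lift Dsl)) y)) 1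
      (‖transposeCL‖ * AD) (2 * μ) :=
    (hasEnvelope_transposeCL_comp_fderiv_fderiv hD hμ hAD0 hd2 hd3).of_mu_le hμ2
  have hDp : ∀ y, ‖fderiv ℝ (fun z : ℝ³ => (stressCL c Rsl Dsl z, n • (z + lift Dsl z))) y‖ ≤ 2 * μ :=
    norm_fderiv_pairCL_le hR hD hn hd1 fun y => (hr1 y).trans (hASμ.trans hμ2)
  have hh := hasEnvelope_mikadoLiftCL_comp (c := c) (n := n) hV hCV0 hCV hR hD h2μ hK hDp
  have hh' := hasEnvelope_fderiv_mikadoLiftCL_comp (c := c) (n := n) hV hCV0 hCV hR hD h2μ hK hDp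
  have hX : HasEnvelope (fun y => (ContinuousLinearMap.inl ℝ 𝕃 ℝ³).comp (fderiv ℝ (stressCL c Rsl Dsl) y)) 1
      AS (2 * μ) :=
    (hasEnvelope_inl_comp_fderiv_stressCL hR hD hμ hAS0 hr1 hr2).of_mu_le hμ2
  -- `T₁ = ∇Φᵀ ∘ (DV ∘ p) ∘ (inl ∘ DR̃)`
  have hT₁' := hh'.bilinear (ContinuousLinearMap.compL ℝ ℝ³ (𝕃 × ℝ³) ℝ³) hX
  have hT₁'' : HasEnvelope (fun y => ContinuousLinearMap.compL ℝ ℝ³ (𝕃 × ℝ³) ℝ³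
      (fderiv ℝ (mikadoLiftCL V) (stressCL c Rsl Dsl y, n • (y + lift Dsl y)))
      ((ContinuousLinearMap.inl ℝ 𝕃 ℝ³).comp (fderiv ℝ (stressCL c Rsl Dsl) y))) 1 (2 * CV * AS) (2 * μ) := by
    refine hT₁'.mono le_rfl ?_
    have h1 : ‖ContinuousLinearMap.compL ℝ ℝ³ (𝕃 × ℝ³) ℝ³‖ ≤ 1 := ContinuousLinearMap.norm_compL_le _ _ _ _
    have h0 : 0 ≤ (2 : ℝ) ^ 1 * CV * AS := by positivity
    calc ‖ContinuousLinearMap.compL ℝ ℝ³ (𝕃 × ℝ³) ℝ³‖ * 2 ^ 1 * CV * AS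
        = ‖ContinuousLinearMap.compL ℝ ℝ³ (𝕃 × ℝ³) ℝ³‖ * (2 ^ 1 * CV * AS) := by ring
      _ ≤ 1 * (2 ^ 1 * CV * AS) := mul_le_mul_of_nonneg_right h1 h0
      _ = 2 * CV * AS := by ring
  have hT₁ := hAT.mul hT₁''
  -- `T₂ = flip(T ∘ D²(lift D)) (V ∘ p)`
  set FL := ((ContinuousLinearMap.flipₗᵢ ℝ ℝ³ ℝ³ ℝ³).toLinearIsometry.toContinuousLinearMap) with hFL
  have hT₂' := hF.bilinear FL hh
  have hT₂ : HasEnvelope (fun y => FL (transposeCL.comp (fderiv ℝ (fderiv ℝ (lift Dsl)) y))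
      (mikadoLiftCL V (stressCL c Rsl Dsl y, n • (y + lift Dsl y)))) 1 (2 * (‖transposeCL‖ * AD) * CV)
      (2 * μ) := by
    refine hT₂'.mono le_rfl ?_
    have h0 : 0 ≤ (2 : ℝ) ^ 1 * (‖transposeCL‖ * AD) * CV := by positivity
    have h1 : ‖FL‖ ≤ 1 := norm_flipCL_le
    calc ‖FL‖ * 2 ^ 1 * (‖transposeCL‖ * AD) * CV = ‖FL‖ * (2 ^ 1 * (‖transposeCL‖ * AD) * CV) := by ring
      _ ≤ 1 * (2 ^ 1 * (‖transposeCL‖ * AD) * CV) := mul_le_mul_of_nonneg_right h1 h0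
      _ = 2 * (‖transposeCL‖ * AD) * CV := by ring
  -- the amplitude `f = σ η` and `f • (T₁ + T₂)`
  have hf : HasEnvelope (fun y => σ * lift ηsl y) 1 σ (2 * μ) := by
    refine HasEnvelope.of_le_one (contDiff_const.mul hη') hσ h2μ (fun y => ?_) (fun y => ?_)
    · rw [norm_mul, Real.norm_eq_abs, Real.norm_eq_abs, abs_of_nonneg hσ]
      exact (mul_le_mul_of_nonneg_left (he0 y) hσ).trans (le_of_eq (mul_one σ))
    · rw [norm_iteratedFDeriv_const_mul σ hη', abs_of_nonneg hσ]
      exact mul_le_mul_of_nonneg_left ((he1 y).trans (hAημ.trans hμ2)) hσ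
  have hfT := hf.smul (hT₁.add hT₂)
  -- `T₃ = (σ Dη).smulRight (∇Φᵀ (V ∘ p))`
  have hφ : HasEnvelope (fun y => σ • fderiv ℝ (lift ηsl) y) 1 (σ * Aη) (2 * μ) := by
    have h0 : HasEnvelope (fderiv ℝ (lift ηsl)) 1 Aη μ := HasEnvelope.fderiv_of_le hη' hAη0 hμ he1 he2
    have h1 := (h0.const_smul σ).of_mu_le hμ2
    rwa [abs_of_nonneg hσ] at h1
  have hu' := hh.bilinear (ContinuousLinearMap.apply ℝ ℝ³) hAT
  have hu : HasEnvelope (fun y => ContinuousLinearMap.apply ℝ ℝ³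
      (mikadoLiftCL V (stressCL c Rsl Dsl y, n • (y + lift Dsl y))) (transposeCL (gradPhiCL Dsl y))) 1
      (2 * CV * (‖transposeCL‖ * 2)) (2 * μ) := by
    refine hu'.mono le_rfl ?_
    have h0 : 0 ≤ (2 : ℝ) ^ 1 * CV * (‖transposeCL‖ * 2) := by positivity
    calc ‖ContinuousLinearMap.apply ℝ ℝ³ (E := ℝ³)‖ * 2 ^ 1 * CV * (‖transposeCL‖ * 2)
        = ‖ContinuousLinearMap.apply ℝ ℝ³ (E := ℝ³)‖ * (2 ^ 1 * CV * (‖transposeCL‖ * 2)) := by ring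
      _ ≤ 1 * (2 ^ 1 * CV * (‖transposeCL‖ * 2)) := mul_le_mul_of_nonneg_right norm_apply_le h0
      _ = 2 * CV * (‖transposeCL‖ * 2) := by ring
  have hT₃' := hφ.bilinear (ContinuousLinearMap.smulRightL ℝ ℝ³ ℝ³) hu
  have hT₃ : HasEnvelope (fun y => ContinuousLinearMap.smulRightL ℝ ℝ³ ℝ³ (σ • fderiv ℝ (lift ηsl) y)
      (ContinuousLinearMap.apply ℝ ℝ³ (mikadoLiftCL V (stressCL c Rsl Dsl y, n • (y + lift Dsl y)))
        (transposeCL (gradPhiCL Dsl y)))) 1 (2 * (σ * Aη) * (2 * CV * (‖transposeCL‖ * 2))) (2 * μ) := by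
    refine hT₃'.mono le_rfl ?_
    have h0 : 0 ≤ (2 : ℝ) ^ 1 * (σ * Aη) * (2 * CV * (‖transposeCL‖ * 2)) := by positivity
    calc ‖ContinuousLinearMap.smulRightL ℝ ℝ³ ℝ³‖ * 2 ^ 1 * (σ * Aη) * (2 * CV * (‖transposeCL‖ * 2))
        = ‖ContinuousLinearMap.smulRightL ℝ ℝ³ ℝ³‖ * (2 ^ 1 * (σ * Aη) * (2 * CV * (‖transposeCL‖ * 2))) := by
          ring
      _ ≤ 1 * (2 ^ 1 * (σ * Aη) * (2 * CV * (‖transposeCL‖ * 2))) :=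
          mul_le_mul_of_nonneg_right ContinuousLinearMap.norm_smulRightL_le h0
      _ = 2 * (σ * Aη) * (2 * CV * (‖transposeCL‖ * 2)) := by ring
  -- assemble
  have hsum := hfT.add hT₃
  refine ⟨hsum.contDiff, by positivity, h2μ, fun i hi y => ?_⟩
  refine (hsum.norm_le hi y).trans (mul_le_mul_of_nonneg_right (le_of_eq ?_) (pow_nonneg (by linarith) _))
  ring

end SlowEnvelope

/-! ## Smoothness of the slow part -/

section SlowSmooth

variable {V : 𝕄 → 𝕋³ → ℝ³} {σ c n : ℝ} {ηsl : 𝕋³ → ℝ} {Rsl : 𝕋³ → Fin 3 → ℝ³} {Dsl : 𝕋³ → ℝ³}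

/-- The slow part of the derivative of the lifted summand is smooth (for smooth slices and a
smooth Mikado lift). [folklore] -/
theorem contDiff_slowDeriv (hV : ContDiff ℝ ∞ (mikadoLift V)) (hη : IsSmooth ηsl) (hR : IsSmooth Rsl)
    (hD : IsSmooth Dsl) : ContDiff ℝ ∞ (slowDeriv V σ c n ηsl Rsl Dsl) := by
  have hη' : ContDiff ℝ ∞ (lift ηsl) := hη
  have hD' : ContDiff ℝ ∞ (lift Dsl) := hD
  have hVs := contDiff_mikadoLiftCL hV
  have hps : ContDiff ℝ ∞ (fun z : ℝ³ => (stressCL c Rsl Dsl z, n • (z + lift Dsl z))) :=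
    contDiff_pairCL (c := c) (n := n) hR hD
  have hAT : ContDiff ℝ ∞ (fun y => transposeCL (gradPhiCL Dsl y)) :=
    transposeCL.contDiff.comp (contDiff_gradPhiCL hD)
  have hh : ContDiff ℝ ∞ (fun y : ℝ³ => mikadoLiftCL V (stressCL c Rsl Dsl y, n • (y + lift Dsl y))) :=
    hVs.comp hps
  have hh' : ContDiff ℝ ∞ (fun y : ℝ³ => fderiv ℝ (mikadoLiftCL V) (stressCL c Rsl Dsl y, n • (y + lift Dsl y))) :=
    (hVs.fderiv_right le_rfl).comp hps
  have hX : ContDiff ℝ ∞ (fun y => (ContinuousLinearMap.inl ℝ 𝕃 ℝ³).comp (fderiv ℝ (stressCL c Rsl Dsl) y)) :=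
    (ContinuousLinearMap.compL ℝ ℝ³ 𝕃 (𝕃 × ℝ³) (ContinuousLinearMap.inl ℝ 𝕃 ℝ³)).contDiff.comp
      ((contDiff_stressCL c hR hD).fderiv_right le_rfl)
  have hF : ContDiff ℝ ∞ (fun y => transposeCL.comp (fderiv ℝ (fderiv ℝ (lift Dsl)) y)) :=
    (ContinuousLinearMap.compL ℝ ℝ³ 𝕃 𝕃 transposeCL).contDiff.comp
      ((hD'.fderiv_right le_rfl).fderiv_right le_rfl)
  have hT₁ : ContDiff ℝ ∞ (fun y => transposeCL (gradPhiCL Dsl y) *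
      (fderiv ℝ (mikadoLiftCL V) (stressCL c Rsl Dsl y, n • (y + lift Dsl y))).comp
        ((ContinuousLinearMap.inl ℝ 𝕃 ℝ³).comp (fderiv ℝ (stressCL c Rsl Dsl) y))) :=
    hAT.mul (hh'.clm_comp hX)
  have hT₂ : ContDiff ℝ ∞ (fun y =>
      ((ContinuousLinearMap.flipₗᵢ ℝ ℝ³ ℝ³ ℝ³).toLinearIsometry.toContinuousLinearMap)
        (transposeCL.comp (fderiv ℝ (fderiv ℝ (lift Dsl)) y))
        (mikadoLiftCL V (stressCL c Rsl Dsl y, n • (y + lift Dsl y)))) :=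
    ((ContinuousLinearMap.contDiff
      ((ContinuousLinearMap.flipₗᵢ ℝ ℝ³ ℝ³ ℝ³).toLinearIsometry.toContinuousLinearMap)).comp hF).clm_apply hh
  have hf : ContDiff ℝ ∞ (fun y => σ * lift ηsl y) := contDiff_const.mul hη'
  have hφ : ContDiff ℝ ∞ (fun y => σ • fderiv ℝ (lift ηsl) y) := (hη'.fderiv_right le_rfl).const_smul σ
  have hu : ContDiff ℝ ∞ (fun y => transposeCL (gradPhiCL Dsl y)
      (mikadoLiftCL V (stressCL c Rsl Dsl y, n • (y + lift Dsl y)))) :=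
    hAT.clm_apply hh
  have hT₃ : ContDiff ℝ ∞ (fun y => (σ • fderiv ℝ (lift ηsl) y).smulRight (transposeCL (gradPhiCL Dsl y)
      (mikadoLiftCL V (stressCL c Rsl Dsl y, n • (y + lift Dsl y))))) :=
    ((ContinuousLinearMap.smulRightL ℝ ℝ³ ℝ³).contDiff.comp hφ).clm_apply hu
  exact (hf.smul (hT₁.add hT₂)).add hT₃

end SlowSmooth

/-! ## On the torus: `w_c` and `∂ⱼ w_c` through the slow parts -/

section Torus

variable {P : Params} {S : Setting} {𝔚 : MikadoDatum mikadoRadius} {η : ℕ → ℝ → 𝕋³ → ℝ}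
  {D : ℕ → ℝ → 𝕋³ → ℝ³} {t : ℝ}

/-- The slow part `slowPartᵢ(t)` of the construction is smooth in `y` (smooth slices). [folklore] -/
theorem contDiff_slowPart {i : ℕ} (hη : IsSmooth (η i t)) (hR : IsSmooth (S.Rbar t)) (hD : IsSmooth (D i t)) :
    ContDiff ℝ ∞ (slowPart P S 𝔚 η D i t) :=
  contDiff_slowDeriv 𝔚.contDiff_mikadoLift_V hη hR hD

/-- **The lift of the corrector**: under the hypotheses of `BDSV.correctorPart_proj` at every point,
`lift (w_c(t)) = n⁻¹ ∑ᵢ curl[slowPartᵢ(t)]` as functions on `ℝ³`. [cite: BuckmasterEtAl2018, §5.3 (5.27)–(5.28)] -/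
theorem lift_correctorPart_eq (hη : ∀ i, IsSmooth (η i t)) (hR : IsSmooth (S.Rbar t))
    (hD : ∀ i, IsSmooth (D i t)) (hsymm : ∀ x, ∀ a b : Fin 3, S.Rbar t x a b = S.Rbar t x b a)
    (hn : P.freqNat (S.q + 1) ≠ 0)
    (hball : ∀ i x, η i t x ≠ 0 → tildeR P S η D i t x ∈ Metric.closedBall (1 : 𝕄) mikadoRadius) :
    lift (correctorPart P S 𝔚 η D t) = fun y =>
      ((P.freqNat (S.q + 1) : ℝ))⁻¹ •
        ∑ i ∈ Finset.range (cutoffCount S.T (P.τ S.q)), curlCLM (slowPart P S 𝔚 η D i t y) :=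
  funext fun y => correctorPart_proj hη hR hD hsymm hn fun i h => hball i (proj y) h

/-- **Sup bound on the corrector through the slow parts**: if `∑ᵢ ‖slowPartᵢ(t, y)‖ ≤ B` for all
`y`, then `‖w_c(t, x)‖ ≤ n⁻¹ ‖curl‖ B`. [cite: BuckmasterEtAl2018, Cor. 5.8 (5.30)] -/
theorem norm_correctorPart_le_of_slowPart (hη : ∀ i, IsSmooth (η i t)) (hR : IsSmooth (S.Rbar t))
    (hD : ∀ i, IsSmooth (D i t)) (hsymm : ∀ x, ∀ a b : Fin 3, S.Rbar t x a b = S.Rbar t x b a)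
    (hn : P.freqNat (S.q + 1) ≠ 0)
    (hball : ∀ i x, η i t x ≠ 0 → tildeR P S η D i t x ∈ Metric.closedBall (1 : 𝕄) mikadoRadius)
    {B : ℝ} (hB : ∀ y, ∑ i ∈ Finset.range (cutoffCount S.T (P.τ S.q)), ‖slowPart P S 𝔚 η D i t y‖ ≤ B)
    (x : 𝕋³) :
    ‖correctorPart P S 𝔚 η D t x‖ ≤ ((P.freqNat (S.q + 1) : ℝ))⁻¹ * (‖curlCLM‖ * B) := by
  obtain ⟨y, rfl⟩ := proj_surjective x
  have h := congrFun (lift_correctorPart_eq (𝔚 := 𝔚) hη hR hD hsymm hn hball) y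
  rw [lift_apply] at h
  rw [h, norm_smul, norm_inv, Real.norm_natCast]
  refine mul_le_mul_of_nonneg_left ?_ (inv_nonneg.2 (Nat.cast_nonneg _))
  refine (norm_sum_le _ _).trans ?_
  calc ∑ i ∈ Finset.range (cutoffCount S.T (P.τ S.q)), ‖curlCLM (slowPart P S 𝔚 η D i t y)‖
      ≤ ∑ i ∈ Finset.range (cutoffCount S.T (P.τ S.q)), ‖curlCLM‖ * ‖slowPart P S 𝔚 η D i t y‖ :=
        Finset.sum_le_sum fun i _ => curlCLM.le_opNorm _
    _ = ‖curlCLM‖ * ∑ i ∈ Finset.range (cutoffCount S.T (P.τ S.q)), ‖slowPart P S 𝔚 η D i t y‖ := by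
        rw [Finset.mul_sum]
    _ ≤ ‖curlCLM‖ * B := mul_le_mul_of_nonneg_left (hB y) (norm_nonneg _)

/-- **Derivative bound on the corrector through the slow parts**: if `∑ᵢ ‖D slowPartᵢ(t, y)‖ ≤ B'`
for all `y`, then `‖∂ⱼ w_c(t, x)‖ ≤ n⁻¹ ‖curl‖ B'` (`∂ⱼ w_c = n⁻¹ ∑ᵢ curl[D slowPartᵢ · eⱼ]`).
[cite: BuckmasterEtAl2018, Cor. 5.8 (5.30)] -/
theorem norm_partialDeriv_correctorPart_le_of_slowPart (hη : ∀ i, IsSmooth (η i t)) (hR : IsSmooth (S.Rbar t))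
    (hD : ∀ i, IsSmooth (D i t)) (hsymm : ∀ x, ∀ a b : Fin 3, S.Rbar t x a b = S.Rbar t x b a)
    (hn : P.freqNat (S.q + 1) ≠ 0)
    (hball : ∀ i x, η i t x ≠ 0 → tildeR P S η D i t x ∈ Metric.closedBall (1 : 𝕄) mikadoRadius)
    {B' : ℝ}
    (hB' : ∀ y, ∑ i ∈ Finset.range (cutoffCount S.T (P.τ S.q)), ‖fderiv ℝ (slowPart P S 𝔚 η D i t) y‖ ≤ B')
    (j : Fin 3) (x : 𝕋³) :
    ‖partialDeriv j (correctorPart P S 𝔚 η D t) x‖ ≤ ((P.freqNat (S.q + 1) : ℝ))⁻¹ * (‖curlCLM‖ * B') := by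
  obtain ⟨y, rfl⟩ := proj_surjective x
  set s := Finset.range (cutoffCount S.T (P.τ S.q)) with hs
  have hsm : ∀ i, ContDiff ℝ ∞ (slowPart P S 𝔚 η D i t) := fun i => contDiff_slowPart (hη i) hR (hD i)
  have hlift := lift_correctorPart_eq (𝔚 := 𝔚) hη hR hD hsymm hn hball
  -- the derivative of the lift
  have hF : HasFDerivAt (lift (correctorPart P S 𝔚 η D t))
      (((P.freqNat (S.q + 1) : ℝ))⁻¹ • ∑ i ∈ s, curlCLM.comp (fderiv ℝ (slowPart P S 𝔚 η D i t) y)) y := by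
    rw [hlift]
    have hsig : HasFDerivAt (fun z => ∑ i ∈ s, curlCLM (slowPart P S 𝔚 η D i t z))
        (∑ i ∈ s, curlCLM.comp (fderiv ℝ (slowPart P S 𝔚 η D i t) y)) y :=
      HasFDerivAt.fun_sum fun i _ =>
        curlCLM.hasFDerivAt.comp y (((hsm i).differentiable (by simp)) y).hasFDerivAt
    exact hsig.const_smul (((P.freqNat (S.q + 1) : ℝ))⁻¹)
  have hC1 : IsContDiff 1 (correctorPart P S 𝔚 η D t) := by
    change ContDiff ℝ 1 (lift (correctorPart P S 𝔚 η D t))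
    rw [hlift]
    have hsig : ContDiff ℝ ∞ (fun z => ∑ i ∈ s, curlCLM (slowPart P S 𝔚 η D i t z)) :=
      ContDiff.sum fun i _ => curlCLM.contDiff.comp (hsm i)
    exact (hsig.const_smul (((P.freqNat (S.q + 1) : ℝ))⁻¹)).of_le (by simp)
  rw [partialDeriv_eq_fderiv_apply hC1, ← fderiv_lift, hF.fderiv, _root_.smul_apply,
    norm_smul, norm_inv, Real.norm_natCast]
  refine mul_le_mul_of_nonneg_left ?_ (inv_nonneg.2 (Nat.cast_nonneg _))
  rw [_root_.sum_apply]
  refine (norm_sum_le _ _).trans ?_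
  calc ∑ i ∈ s, ‖(curlCLM.comp (fderiv ℝ (slowPart P S 𝔚 η D i t) y)) (EuclideanSpace.single j 1)‖
      ≤ ∑ i ∈ s, ‖curlCLM‖ * ‖fderiv ℝ (slowPart P S 𝔚 η D i t) y‖ := Finset.sum_le_sum fun i _ => by
        rw [ContinuousLinearMap.comp_apply]
        refine (curlCLM.le_opNorm _).trans (mul_le_mul_of_nonneg_left ?_ (norm_nonneg _))
        refine ((fderiv ℝ (slowPart P S 𝔚 η D i t) y).le_opNorm _).trans ?_
        rw [PiLp.norm_single, norm_one, mul_one]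
    _ = ‖curlCLM‖ * ∑ i ∈ s, ‖fderiv ℝ (slowPart P S 𝔚 η D i t) y‖ := by rw [Finset.mul_sum]
    _ ≤ ‖curlCLM‖ * B' := mul_le_mul_of_nonneg_left (hB' y) (norm_nonneg _)

end Torus

/-! ## Pointwise inputs under the standing hypotheses -/

section Inputs

variable {P : Params} {S : Setting} {Nbar : ℕ} {Cin C₀ c₀ : ℝ} {Cη : ℕ → ℕ → ℝ}

/-- Lemma 5.3 pointwise: `‖Dʲ(lift ηᵢ(t))‖ ≤ max(C_η(0,2), 0)` for `j ≤ 2`, `t ∈ [0,T]`.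
[cite: BuckmasterEtAl2018, Lemma 5.3] -/
theorem PerturbationData.norm_iteratedFDeriv_lift_eta_le (𝒟 : PerturbationData P S c₀ Cη) (i : ℕ) {t : ℝ}
    (ht : t ∈ Icc 0 S.T) {j : ℕ} (hj : j ≤ 2) (y : ℝ³) :
    ‖iteratedFDeriv ℝ j (lift (𝒟.cut.η i t)) y‖ ≤ max (Cη 0 2) 0 := by
  have h := 𝒟.cut.deriv_le i 0 2 t ht
  simp only [Function.iterate_zero, id_eq, Nat.cast_zero, neg_zero, Real.rpow_zero, mul_one] at h
  exact norm_iteratedFDeriv_lift_le_of_eContDiffHolderNorm_le h hj y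

/-- **The normalised stress derivatives**: with `c = ∑∫η_j²/ρ_q`, `o = ‖ofColsCL‖`, under
`4δ_{q+2} ≤ δ_{q+1}λ_q^{-α}` and the smallness `8 o C_in λ_q^α ℓ^α ≤ 1`,
`|c| o ‖Dᵏ(lift R̊̄_q(t))‖ ≤ ℓ^{-k}` for `k = 0, 1, 2` (`k ≤ N̄`) — from (2.20) `‖R̊̄_q‖_{k+α} ≤ C_in δ_{q+1} ℓ^{-k+α}`
and `c ≤ 8λ_q^α/δ_{q+1}` (the "crude estimate" `‖R/ρ‖_N ≲ 1 + ℓ^{-N+α} λ_q^α ≲ ℓ^{-N}` of Prop. 5.7).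
[cite: BuckmasterEtAl2018, Prop. 5.7 (proof, (5.32)–(5.33))] -/
theorem PerturbationData.abs_c_mul_norm_iteratedFDeriv_lift_Rbar_le (H : PerturbationHypotheses P S Nbar Cin C₀)
    (𝒟 : PerturbationData P S c₀ Cη) (hCin : 0 ≤ Cin) (ha : 1 ≤ P.a)
    (h4 : 4 * amp P.β P.a P.b (S.q + 2) ≤ amp P.β P.a P.b (S.q + 1) * freq P.a P.b S.q ^ (-P.α))
    (hstr : 8 * ‖ofColsCL‖ * Cin * (freq P.a P.b S.q ^ P.α * mollScale P.β P.α P.a P.b S.q ^ P.α) ≤ 1)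
    {k : ℕ} (hk : k ≤ Nbar) {t : ℝ} (ht : t ∈ Icc 0 S.T) (y : ℝ³) :
    |etaMass P S 𝒟.cut.η t / rhoQ P S t| * ‖ofColsCL‖ * ‖iteratedFDeriv ℝ k (lift (S.Rbar t)) y‖ ≤
      (mollScale P.β P.α P.a P.b S.q)⁻¹ ^ k := by
  obtain ⟨hc0, hc⟩ := 𝒟.etaMass_div_rhoQ_le H ha h4 ht
  have hℓ := mollScale_pos (β := P.β) (α := P.α) (b := P.b) ha S.q
  have hδ : 0 < amp P.β P.a P.b (S.q + 1) := amp_pos ha _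
  have hr := H.norm_iteratedFDeriv_lift_Rbar_le hCin ha hk le_rfl ht y
  have hsplit : mollScale P.β P.α P.a P.b S.q ^ (-(k : ℝ) + P.α) =
      (mollScale P.β P.α P.a P.b S.q)⁻¹ ^ k * mollScale P.β P.α P.a P.b S.q ^ P.α := by
    rw [Real.rpow_add hℓ, Real.rpow_neg hℓ.le, Real.rpow_natCast, inv_pow]
  rw [abs_of_nonneg hc0]
  calc etaMass P S 𝒟.cut.η t / rhoQ P S t * ‖ofColsCL‖ * ‖iteratedFDeriv ℝ k (lift (S.Rbar t)) y‖
      ≤ (8 * freq P.a P.b S.q ^ P.α / amp P.β P.a P.b (S.q + 1)) * ‖ofColsCL‖ *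
          (Cin * (amp P.β P.a P.b (S.q + 1) * mollScale P.β P.α P.a P.b S.q ^ (-(k : ℝ) + P.α))) :=
        mul_le_mul (mul_le_mul_of_nonneg_right hc (norm_nonneg _)) hr (norm_nonneg _)
          (mul_nonneg (div_nonneg (mul_nonneg (by norm_num) (Real.rpow_nonneg (freq_pos ha _).le _)) hδ.le)
            (norm_nonneg _))
    _ = 8 * ‖ofColsCL‖ * Cin * (freq P.a P.b S.q ^ P.α * mollScale P.β P.α P.a P.b S.q ^ P.α) *
          (mollScale P.β P.α P.a P.b S.q)⁻¹ ^ k := by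
        rw [hsplit]; field_simp
    _ ≤ 1 * (mollScale P.β P.α P.a P.b S.q)⁻¹ ^ k :=
        mul_le_mul_of_nonneg_right hstr (pow_nonneg (inv_nonneg.2 hℓ.le) _)
    _ = _ := one_mul _

/-- **Flow bounds on the support of a cut-off** (App. B (B.4)–(B.5) for the backward flow `Φᵢ`,
localised by property (iv): `|t - tᵢ*| ≤ 4τ_q/3`, and `τ_q δ_q^{1/2}λ_q C_in = C_in ℓ^{2α} =: u`): if
`u ≤ 1/2400` then wherever `ηᵢ(t,·) ≠ 0` somewhere,
`‖D(lift Dᵢ(t))‖ ≤ 1/600`, `‖D²(lift Dᵢ(t))‖ ≤ ℓ⁻¹`, `‖D³(lift Dᵢ(t))‖ ≤ 2ℓ⁻²` (the content of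
Lemma 5.4 (5.14) and Prop. 5.7 (5.23) at orders `≤ 2`, with `N̄ ≥ 2`).
[cite: BuckmasterEtAl2018, Lemma 5.4 (5.14) and Prop. 5.7 (arXiv (5.23))] -/
theorem PerturbationData.norm_iteratedFDeriv_lift_D_le (H : PerturbationHypotheses P S Nbar Cin C₀)
    (𝒟 : PerturbationData P S c₀ Cη) (hNbar : 2 ≤ Nbar) (hCin : 0 ≤ Cin) (ha : 1 ≤ P.a) (hb : 1 ≤ P.b)
    (hβ : 0 ≤ P.β) (hα : 0 ≤ P.α)
    (hu : Cin * mollScale P.β P.α P.a P.b S.q ^ (2 * P.α) ≤ 1 / 2400)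
    {i : ℕ} {t : ℝ} (ht : t ∈ Icc 0 S.T) {x' : 𝕋³} (hη : 𝒟.cut.η i t x' ≠ 0) (y : ℝ³) :
    ‖iteratedFDeriv ℝ 1 (lift (𝒟.D i t)) y‖ ≤ 1 / 600 ∧
      ‖iteratedFDeriv ℝ 2 (lift (𝒟.D i t)) y‖ ≤ (mollScale P.β P.α P.a P.b S.q)⁻¹ ∧
      ‖iteratedFDeriv ℝ 3 (lift (𝒟.D i t)) y‖ ≤ 2 * (mollScale P.β P.α P.a P.b S.q)⁻¹ ^ 2 := by
  set ℓ := mollScale P.β P.α P.a P.b S.q with hℓdef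
  set Λ := Cin * (Real.sqrt (amp P.β P.a P.b S.q) * freq P.a P.b S.q) with hΛdef
  set u := Cin * ℓ ^ (2 * P.α) with hudef
  have hℓ : 0 < ℓ := mollScale_pos ha S.q
  have hℓ1 : ℓ ≤ 1 := mollScale_le_one_of_params ha hb hβ hα S.q
  have hτ : 0 < P.τ S.q := glueScale_pos ha S.q
  have hΛ0 : 0 ≤ Λ := mul_nonneg hCin (mul_nonneg (Real.sqrt_nonneg _) (freq_pos ha _).le)
  have hu0 : 0 ≤ u := mul_nonneg hCin (Real.rpow_nonneg hℓ.le _)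
  have hΛτ : Λ * P.τ S.q = u := velocityBound_mul_tau ha S.q
  -- bounds on the velocity derivatives
  have hV : ∀ N : ℕ, N ≤ Nbar → ∀ s ∈ Icc 0 S.T, ∀ z : ℝ³,
      ‖iteratedFDeriv ℝ (N + 1) (lift (S.vbar s)) z‖ ≤ Λ * ℓ⁻¹ ^ N := by
    intro N hN s hs z
    have h := H.norm_iteratedFDeriv_lift_vbar_le hCin ha hN le_rfl hs z
    rwa [Real.rpow_neg hℓ.le, Real.rpow_natCast, ← inv_pow, ← mul_assoc, ← hΛdef] at h
  have hb₁ : ∀ s ∈ Icc 0 S.T, ∀ z : ℝ³, ‖iteratedFDeriv ℝ 1 (lift (S.vbar s)) z‖ ≤ Λ := fun s hs z => by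
    simpa using hV 0 (Nat.zero_le _) s hs z
  have hb₂ : ∀ s ∈ Icc 0 S.T, ∀ z : ℝ³, ‖iteratedFDeriv ℝ 2 (lift (S.vbar s)) z‖ ≤ Λ * ℓ⁻¹ := fun s hs z => by
    simpa using hV 1 (le_trans (by norm_num) hNbar) s hs z
  have hb₃ : ∀ s ∈ Icc 0 S.T, ∀ z : ℝ³, ‖iteratedFDeriv ℝ 3 (lift (S.vbar s)) z‖ ≤ Λ * ℓ⁻¹ ^ 2 :=
    fun s hs z => hV 2 hNbar s hs z
  -- time localisation
  have hanchor : min ((i : ℝ) * P.τ S.q) S.T ∈ Icc 0 S.T :=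
    ⟨le_min (mul_nonneg i.cast_nonneg hτ.le) H.pos_T.le, min_le_right _ _⟩
  have hdt : |t - min ((i : ℝ) * P.τ S.q) S.T| ≤ 4 * P.τ S.q / 3 := CutoffFamily.abs_sub_anchor_le hτ 𝒟.cut ht hη
  set d := |t - min ((i : ℝ) * P.τ S.q) S.T| with hddef
  have hd0 : 0 ≤ d := abs_nonneg _
  have hdΛ : d * Λ ≤ 4 * u / 3 := by
    calc d * Λ ≤ (4 * P.τ S.q / 3) * Λ := mul_le_mul_of_nonneg_right hdt hΛ0
      _ = 4 * (Λ * P.τ S.q) / 3 := by ring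
      _ = 4 * u / 3 := by rw [hΛτ]
  have hdΛ1 : d * Λ ≤ 1 := hdΛ.trans (by linarith)
  obtain ⟨h1, h2, h3⟩ := FlowDisplacement.norm_iteratedFDeriv_lift_le H.pos_T H.eulerReynolds.smooth_velocity
    hanchor (𝒟.flow i) hΛ0 (mul_nonneg hΛ0 (inv_nonneg.2 hℓ.le)) (mul_nonneg hΛ0 (pow_nonneg (inv_nonneg.2 hℓ.le) 2))
    hb₁ hb₂ hb₃ ht hdΛ1 y
  have hℓi : 0 ≤ ℓ⁻¹ := inv_nonneg.2 hℓ.le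
  have hℓi1 : 1 ≤ ℓ⁻¹ := one_le_inv_iff₀.2 ⟨hℓ, hℓ1⟩
  refine ⟨?_, ?_, ?_⟩
  · calc ‖iteratedFDeriv ℝ 1 (lift (𝒟.D i t)) y‖ ≤ 3 * Λ * d := h1
      _ = 3 * (d * Λ) := by ring
      _ ≤ 3 * (4 * u / 3) := by nlinarith
      _ ≤ 1 / 600 := by nlinarith
  · calc ‖iteratedFDeriv ℝ 2 (lift (𝒟.D i t)) y‖ ≤ 32 * (Λ * ℓ⁻¹) * d := h2
      _ = 32 * (d * Λ) * ℓ⁻¹ := by ring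
      _ ≤ 32 * (4 * u / 3) * ℓ⁻¹ := by gcongr
      _ ≤ ℓ⁻¹ := by nlinarith
  · calc ‖iteratedFDeriv ℝ 3 (lift (𝒟.D i t)) y‖ ≤ 2100 * (Λ * ℓ⁻¹ ^ 2 + (Λ * ℓ⁻¹) ^ 2 * d) * d := h3
      _ = 2100 * ((d * Λ) * ℓ⁻¹ ^ 2 + (d * Λ) * (d * Λ) * ℓ⁻¹ ^ 2) := by ring
      _ ≤ 2100 * ((4 * u / 3) * ℓ⁻¹ ^ 2 + (4 * u / 3) * (4 * u / 3) * ℓ⁻¹ ^ 2) := by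
          gcongr
      _ = 2100 * (4 * u / 3 + (4 * u / 3) * (4 * u / 3)) * ℓ⁻¹ ^ 2 := by ring
      _ ≤ 2 * ℓ⁻¹ ^ 2 := by
          refine mul_le_mul_of_nonneg_right ?_ (pow_nonneg hℓi 2)
          have hw : 4 * u / 3 ≤ 1 / 1800 := by linarith
          have hw0 : 0 ≤ 4 * u / 3 := by positivity
          have hww : (4 * u / 3) * (4 * u / 3) ≤ (1 / 1800) * (4 * u / 3) := mul_le_mul_of_nonneg_right hw hw0
          linarith

end Inputs

/-! ## The envelope of the slow parts of the construction -/

section SlowPartEnvelope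

variable {P : Params} {S : Setting} {Nbar : ℕ} {Cin C₀ c₀ : ℝ} {Cη : ℕ → ℕ → ℝ}

/-- `0 ≤ corrAmp`. [folklore] -/
theorem corrAmp_nonneg (Cη : ℕ → ℕ → ℝ) (c₀ : ℝ) {CV : ℝ} (hCV : 0 ≤ CV) :
    0 ≤ (‖transposeCL‖ * CV * (16 * (32 * ‖transposeCL‖) + 4 * 2 + 8 * max (Cη 0 2) 0) / Real.sqrt c₀) := by
  positivity

/-- `1 ≤ corrFreq`. [folklore] -/
theorem one_le_corrFreq (Cη : ℕ → ℕ → ℝ) :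
    1 ≤ (2 * Real.pi * (32 * ‖transposeCL‖ + 3) + max (Cη 0 2) 0 + 1) := by
  have := Real.pi_pos
  have : 0 ≤ max (Cη 0 2) 0 := le_max_right _ _
  nlinarith [norm_nonneg transposeCL]


/-- The frequency inequalities behind the choice `μ = corrFreq · n`: for `n ≥ 1` and
`0 ≤ L ≤ 2πn` (`L = ℓ⁻¹ ≤ λ_{q+1}`), `μ` dominates `1`, `n`, `L`, `32‖T‖L`, `2L` and `max(C_η(0,2),0)`.
[folklore] -/
theorem corrFreq_mul_bounds (Cη : ℕ → ℕ → ℝ) {n L : ℝ} (hn : 1 ≤ n) (hL0 : 0 ≤ L) (hL : L ≤ 2 * Real.pi * n) :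
    let μ : ℝ := (2 * Real.pi * (32 * ‖transposeCL‖ + 3) + max (Cη 0 2) 0 + 1) * n
    1 ≤ μ ∧ n ≤ μ ∧ L ≤ μ ∧ 32 * ‖transposeCL‖ * L ≤ μ ∧ 2 * L ≤ μ ∧ max (Cη 0 2) 0 ≤ μ := by
  intro μ
  have hθ : 0 ≤ ‖transposeCL‖ := norm_nonneg _
  have hK : 0 ≤ max (Cη 0 2) 0 := le_max_right _ _
  have hπ : 2 ≤ Real.pi := Real.two_le_pi
  have hn0 : 0 ≤ n := by linarith
  have e : μ = 2 * Real.pi * n * (32 * ‖transposeCL‖) + 3 * (2 * Real.pi * n) + max (Cη 0 2) 0 * n + n := by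
    simp only [μ]; ring
  rw [e]
  have h1 : 0 ≤ 2 * Real.pi * n * (32 * ‖transposeCL‖) := by positivity
  have h2 : L * (32 * ‖transposeCL‖) ≤ 2 * Real.pi * n * (32 * ‖transposeCL‖) :=
    mul_le_mul_of_nonneg_right hL (by positivity)
  have h3 : max (Cη 0 2) 0 * 1 ≤ max (Cη 0 2) 0 * n := mul_le_mul_of_nonneg_left hn hK
  refine ⟨?_, ?_, ?_, ?_, ?_, ?_⟩ <;> nlinarith

/-- The amplitude comparison behind `corrAmp`: with `0 ≤ σ ≤ s/√c₀`, `1 ≤ L`, `K ≥ 0`,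
`σ‖T‖C_V(16·32‖T‖L + 4·2L + 8K) ≤ corrAmp · s L` (for `K = max(C_η(0,2),0)`). [folklore] -/
theorem corrAmp_mul_bound (Cη : ℕ → ℕ → ℝ) {c₀ CV σ s L : ℝ} (hCV : 0 ≤ CV) (hs : 0 ≤ s)
    (hσ : σ ≤ s / Real.sqrt c₀) (hL : 1 ≤ L) :
    σ * ‖transposeCL‖ * CV * (16 * (32 * ‖transposeCL‖ * L) + 4 * (2 * L) + 8 * max (Cη 0 2) 0) ≤
      (‖transposeCL‖ * CV * (16 * (32 * ‖transposeCL‖) + 4 * 2 + 8 * max (Cη 0 2) 0) / Real.sqrt c₀) * s * L := by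
  have hθ : 0 ≤ ‖transposeCL‖ := norm_nonneg _
  have hK : 0 ≤ max (Cη 0 2) 0 := le_max_right _ _
  have hL0 : 0 ≤ L := zero_le_one.trans hL
  have h1 : 16 * (32 * ‖transposeCL‖ * L) + 4 * (2 * L) + 8 * max (Cη 0 2) 0 ≤
      (16 * (32 * ‖transposeCL‖) + 4 * 2 + 8 * max (Cη 0 2) 0) * L := by
    nlinarith [mul_nonneg hK hL0]
  have h2 : σ * ‖transposeCL‖ * CV * (16 * (32 * ‖transposeCL‖ * L) + 4 * (2 * L) + 8 * max (Cη 0 2) 0) ≤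
      (s / Real.sqrt c₀) * ‖transposeCL‖ * CV * ((16 * (32 * ‖transposeCL‖) + 4 * 2 + 8 * max (Cη 0 2) 0) * L) :=
    mul_le_mul (mul_le_mul_of_nonneg_right (mul_le_mul_of_nonneg_right hσ hθ) hCV) h1 (by positivity)
      (by positivity)
  refine h2.trans (le_of_eq ?_)
  ring

/-- The arithmetic of (5.32)–(5.33) at orders one and two: with `d₂ ≤ L`, `d₃ ≤ 2L²`, `e₁ ≤ L`,
`e₂ ≤ L²` (nonnegative quantities, `L ≤ μ`), `‖T‖(8d₂ + 4e₁) ≤ 32‖T‖L` and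
`‖T‖(8d₃ + 8e₁d₂ + 4d₂² + 4e₂) ≤ 32‖T‖Lμ`. [folklore] -/
theorem stress_orders_arith {θ d₂ d₃ e₁ e₂ L μ : ℝ} (hθ : 0 ≤ θ) (hd₂0 : 0 ≤ d₂) (hL0 : 0 ≤ L)
    (hd₂ : d₂ ≤ L) (hd₃ : d₃ ≤ 2 * L ^ 2) (he₁ : e₁ ≤ L) (he₂ : e₂ ≤ L ^ 2) (hLμ : L ≤ μ) :
    θ * (8 * d₂ + 4 * e₁) ≤ 32 * θ * L ∧
      θ * (8 * d₃ + 8 * e₁ * d₂ + 4 * d₂ ^ 2 + 4 * e₂) ≤ 32 * θ * L * μ := by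
  have hp : e₁ * d₂ ≤ L * L := mul_le_mul he₁ hd₂ hd₂0 hL0
  have hsq : d₂ ^ 2 ≤ L ^ 2 := pow_le_pow_left₀ hd₂0 hd₂ 2
  constructor
  · nlinarith
  · have h : 8 * d₃ + 8 * e₁ * d₂ + 4 * d₂ ^ 2 + 4 * e₂ ≤ 32 * L * L := by nlinarith
    calc θ * (8 * d₃ + 8 * e₁ * d₂ + 4 * d₂ ^ 2 + 4 * e₂) ≤ θ * (32 * L * L) := mul_le_mul_of_nonneg_left h hθ
      _ = 32 * θ * L * L := by ring
      _ ≤ 32 * θ * L * μ := mul_le_mul_of_nonneg_left hLμ (by positivity)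

/-- **The slow part of the construction has a two-scale envelope** (the quantitative core of
Cor. 5.8 (5.30)): under the standing hypotheses with `N̄ ≥ 2`, `C_in ≥ 0`, `c₀ > 0`, and the parameter
inequalities `4δ_{q+2} ≤ δ_{q+1}λ_q^{-α}`, `C_in ℓ^{2α} ≤ 1/2400`, `8‖ofCols‖C_in λ_q^αℓ^α ≤ 1` and (6.6)
`ℓ⁻¹λ_{q+1}⁻¹ ≤ 1` (all valid for `a` large), if `‖DᵐV‖ ≤ C_V` (`m ≤ 2`) on the ball of radius
`BDSV.(3 + 4 * ‖transposeCL‖)` about `Id`, then for `t ∈ [0,T]` and every `i` with `ηᵢ(t,·) ≢ 0`,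
`slowPartᵢ(t)` has the order-one envelope `(corrAmp · δ_{q+1}^{1/2} ℓ⁻¹, 2 corrFreq · n_{q+1})`:
`‖slowPartᵢ‖ ≲ δ_{q+1}^{1/2}ℓ⁻¹` and `‖D slowPartᵢ‖ ≲ δ_{q+1}^{1/2}ℓ⁻¹λ_{q+1}`.
[cite: BuckmasterEtAl2018, Cor. 5.8 (5.30) with Prop. 5.7 (5.23)–(5.26) and Lemma 5.4] -/
theorem PerturbationData.hasEnvelope_slowPart (H : PerturbationHypotheses P S Nbar Cin C₀)
    (𝒟 : PerturbationData P S c₀ Cη) (𝔚 : MikadoDatum mikadoRadius) (hNbar : 2 ≤ Nbar) (hc₀ : 0 < c₀)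
    (hCin : 0 ≤ Cin) (ha : 1 ≤ P.a) (hb : 1 ≤ P.b) (hβ : 0 ≤ P.β) (hα : 0 ≤ P.α)
    (h4 : 4 * amp P.β P.a P.b (S.q + 2) ≤ amp P.β P.a P.b (S.q + 1) * freq P.a P.b S.q ^ (-P.α))
    (hu : Cin * mollScale P.β P.α P.a P.b S.q ^ (2 * P.α) ≤ 1 / 2400)
    (hstr : 8 * ‖ofColsCL‖ * Cin * (freq P.a P.b S.q ^ P.α * mollScale P.β P.α P.a P.b S.q ^ P.α) ≤ 1)
    (h66 : (mollScale P.β P.α P.a P.b S.q)⁻¹ * (freq P.a P.b (S.q + 1))⁻¹ ≤ 1)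
    {CV : ℝ} (hCV0 : 0 ≤ CV)
    (hCV : ∀ m ≤ 2, ∀ L ∈ Metric.closedBall (1 : 𝕃) (3 + 4 * ‖transposeCL‖), ∀ ξ : ℝ³,
      ‖iteratedFDeriv ℝ m (mikadoLiftCL 𝔚.V) (L, ξ)‖ ≤ CV)
    {i : ℕ} {t : ℝ} (ht : t ∈ Icc 0 S.T) {x' : 𝕋³} (hη : 𝒟.cut.η i t x' ≠ 0) :
    HasEnvelope (slowPart P S 𝔚 𝒟.cut.η 𝒟.D i t) 1
      ((‖transposeCL‖ * CV * (16 * (32 * ‖transposeCL‖) + 4 * 2 + 8 * max (Cη 0 2) 0) / Real.sqrt c₀) *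
        Real.sqrt (amp P.β P.a P.b (S.q + 1)) * (mollScale P.β P.α P.a P.b S.q)⁻¹)
      (2 * ((2 * Real.pi * (32 * ‖transposeCL‖ + 3) + max (Cη 0 2) 0 + 1) * P.freqNat (S.q + 1))) := by
  -- names
  set ℓ := mollScale P.β P.α P.a P.b S.q with hℓdef
  set θ : ℝ := ‖transposeCL‖ with hθdef
  set Kη : ℝ := max (Cη 0 2) 0 with hKηdef
  set σ : ℝ := Real.sqrt (rhoQ P S t / etaMass P S 𝒟.cut.η t) with hσdef
  set c : ℝ := etaMass P S 𝒟.cut.η t / rhoQ P S t with hcdef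
  set n : ℝ := (P.freqNat (S.q + 1) : ℝ) with hndef
  set μ : ℝ := (2 * Real.pi * (32 * ‖transposeCL‖ + 3) + max (Cη 0 2) 0 + 1) * n with hμdef
  have hθ : 0 ≤ θ := norm_nonneg _
  have hKη : 0 ≤ Kη := le_max_right _ _
  have hℓ : 0 < ℓ := mollScale_pos ha S.q
  have hℓ1 : ℓ ≤ 1 := mollScale_le_one_of_params ha hb hβ hα S.q
  have hℓi : 0 ≤ ℓ⁻¹ := inv_nonneg.2 hℓ.le
  have hℓi1 : 1 ≤ ℓ⁻¹ := one_le_inv_iff₀.2 ⟨hℓ, hℓ1⟩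
  have hσ0 : 0 ≤ σ := Real.sqrt_nonneg _
  have hσ : σ ≤ Real.sqrt (amp P.β P.a P.b (S.q + 1)) / Real.sqrt c₀ := by
    rw [← Real.sqrt_div (amp_pos ha _).le]
    exact 𝒟.sqrt_rhoQ_div_etaMass_le H hc₀ ha ht
  -- the frequency `n` and `μ`
  have ha0 : 0 < P.a := by linarith
  have hn1 : 1 ≤ n := by
    rw [hndef]
    exact_mod_cast Nat.one_le_iff_ne_zero.2 (Nat.pos_iff_ne_zero.1 (Nat.ceil_pos.2 (Real.rpow_pos_of_pos ha0 _)))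
  have hn0 : 0 ≤ n := zero_le_one.trans hn1
  have hfreq : freq P.a P.b (S.q + 1) = 2 * Real.pi * n := P.freq_eq ha0.le (S.q + 1)
  have hfreqpos : 0 < freq P.a P.b (S.q + 1) := freq_pos ha _
  have hℓn : ℓ⁻¹ ≤ 2 * Real.pi * n := by
    rw [← hfreq]
    have := mul_le_mul_of_nonneg_right h66 hfreqpos.le
    rwa [mul_assoc, inv_mul_cancel₀ hfreqpos.ne', mul_one, one_mul] at this
  obtain ⟨hμ1, -, hℓμ, hASμ, hADμ, hAημ⟩ := corrFreq_mul_bounds Cη hn1 hℓi hℓn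
  have hμ0 : 0 ≤ μ := zero_le_one.trans hμ1
  have hnμ : |n| ≤ μ := by rw [abs_of_nonneg hn0]; exact (corrFreq_mul_bounds Cη hn1 hℓi hℓn).2.1
  -- smooth slices
  have hηs : IsSmooth (𝒟.cut.η i t) := (𝒟.cut.smooth i).isSmooth_slice ht
  have hRs : IsSmooth (S.Rbar t) := H.eulerReynolds.smooth_stress.isSmooth_slice ht
  have hDs : IsSmooth (𝒟.D i t) := (𝒟.flow i).smooth.isSmooth_slice ht
  -- the cut-off
  have he0 : ∀ y, |lift (𝒟.cut.η i t) y| ≤ 1 := fun y => by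
    rw [lift_apply, abs_of_nonneg (𝒟.cut.nonneg i t _)]; exact 𝒟.cut.le_one i t _
  have he1 : ∀ y, ‖iteratedFDeriv ℝ 1 (lift (𝒟.cut.η i t)) y‖ ≤ Kη := fun y =>
    𝒟.norm_iteratedFDeriv_lift_eta_le i ht (by norm_num) y
  have he2 : ∀ y, ‖iteratedFDeriv ℝ 2 (lift (𝒟.cut.η i t)) y‖ ≤ Kη * μ := fun y =>
    (𝒟.norm_iteratedFDeriv_lift_eta_le i ht le_rfl y).trans (le_mul_of_one_le_right hKη hμ1)
  -- the flow
  have hd : ∀ y, ‖iteratedFDeriv ℝ 1 (lift (𝒟.D i t)) y‖ ≤ 1 / 600 ∧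
      ‖iteratedFDeriv ℝ 2 (lift (𝒟.D i t)) y‖ ≤ ℓ⁻¹ ∧ ‖iteratedFDeriv ℝ 3 (lift (𝒟.D i t)) y‖ ≤ 2 * ℓ⁻¹ ^ 2 :=
    fun y => 𝒟.norm_iteratedFDeriv_lift_D_le H hNbar hCin ha hb hβ hα hu ht hη y
  have hd1 : ∀ y, ‖iteratedFDeriv ℝ 1 (lift (𝒟.D i t)) y‖ ≤ 1 := fun y => (hd y).1.trans (by norm_num)
  have hd2 : ∀ y, ‖iteratedFDeriv ℝ 2 (lift (𝒟.D i t)) y‖ ≤ 2 * ℓ⁻¹ := fun y => (hd y).2.1.trans (by linarith)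
  have hd3 : ∀ y, ‖iteratedFDeriv ℝ 3 (lift (𝒟.D i t)) y‖ ≤ 2 * ℓ⁻¹ * μ := fun y =>
    (hd y).2.2.trans (by rw [pow_two, ← mul_assoc]; exact mul_le_mul_of_nonneg_left hℓμ (by positivity))
  -- the stress
  have hcr : ∀ k : ℕ, k ≤ 2 → ∀ y, |c| * ‖ofColsCL‖ * ‖iteratedFDeriv ℝ k (lift (S.Rbar t)) y‖ ≤ ℓ⁻¹ ^ k :=
    fun k hk y => 𝒟.abs_c_mul_norm_iteratedFDeriv_lift_Rbar_le H hCin ha h4 hstr (hk.trans hNbar) ht y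
  have hr0 : ∀ y, |c| * ‖ofColsCL‖ * ‖lift (S.Rbar t) y‖ ≤ 1 := fun y => by
    have := hcr 0 (by norm_num) y
    rwa [norm_iteratedFDeriv_zero, pow_zero] at this
  have hst : ∀ y, ‖iteratedFDeriv ℝ 1 (stressCL c (S.Rbar t) (𝒟.D i t)) y‖ ≤ 32 * θ * ℓ⁻¹ ∧
      ‖iteratedFDeriv ℝ 2 (stressCL c (S.Rbar t) (𝒟.D i t)) y‖ ≤ 32 * θ * ℓ⁻¹ * μ := by
    intro y
    obtain ⟨h1, h2⟩ := norm_iteratedFDeriv_stressCL_le c hRs hDs y (hd1 y) (hr0 y)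
    have e1 := hcr 1 (by norm_num) y
    have e2 := hcr 2 le_rfl y
    rw [pow_one] at e1
    obtain ⟨-, f2, f3⟩ := hd y
    obtain ⟨a1, a2⟩ := stress_orders_arith (θ := θ) hθ (norm_nonneg _) hℓi f2 f3 e1 e2 hℓμ
    exact ⟨h1.trans a1, h2.trans a2⟩
  -- confinement in the carrier
  have hK : ∀ y, stressCL c (S.Rbar t) (𝒟.D i t) y ∈ Metric.closedBall (1 : 𝕃) (3 + 4 * ‖transposeCL‖) := fun y => by
    rw [Metric.mem_closedBall, dist_eq_norm, ← hθdef]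
    refine (norm_stressCL_sub_one_le c (S.Rbar t) (𝒟.D i t) y (hd1 y)).trans ?_
    rw [← hθdef]
    have f1 := (hd y).1
    have g0 := hr0 y
    have hθ1 : 0 ≤ 1 + 2 * θ := by linarith only [hθ]
    have hθ2 : 0 ≤ 2 * (1 + θ) := by linarith only [hθ]
    have k1 := mul_le_mul_of_nonneg_left f1 hθ1
    have k2 := mul_le_mul_of_nonneg_left g0 hθ2
    linarith only [k1, k2, hθ]
  -- the abstract envelope
  have key := hasEnvelope_slowDeriv (V := 𝔚.V) (σ := σ) (c := c) (n := n) (ηsl := 𝒟.cut.η i t)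
    (Rsl := S.Rbar t) (Dsl := 𝒟.D i t) 𝔚.contDiff_mikadoLift_V hCV0 hCV hσ0 hμ1 hnμ hKη hAημ
    (by positivity : (0 : ℝ) ≤ 2 * ℓ⁻¹) hADμ (by positivity : (0 : ℝ) ≤ 32 * θ * ℓ⁻¹) hASμ hηs hRs hDs
    he0 he1 he2 hd1 hd2 hd3 hK (fun y => (hst y).1) (fun y => (hst y).2)
  -- compare the amplitudes
  have hamp := corrAmp_mul_bound Cη (c₀ := c₀) (L := ℓ⁻¹) hCV0 (Real.sqrt_nonneg _) hσ hℓi1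
  exact key.mono le_rfl hamp

end SlowPartEnvelope

/-! ## Inactive cut-offs, and at most two active ones -/

section Counting

variable {P : Params} {S : Setting} {𝔚 : MikadoDatum mikadoRadius} {η : ℕ → ℝ → 𝕋³ → ℝ}
  {D : ℕ → ℝ → 𝕋³ → ℝ³} {i : ℕ} {t : ℝ}

/-- If `ηᵢ(t, ·) ≡ 0` (and `ηᵢ ≥ 0`), the slow part `slowPartᵢ(t)` vanishes identically. [folklore] -/
theorem slowPart_eq_zero_of_eta_eq_zero (h0 : ∀ x, 0 ≤ η i t x) (h : ∀ x, η i t x = 0) :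
    slowPart P S 𝔚 η D i t = fun _ => 0 := by
  funext y
  have hy : lift (η i t) y = 0 := h (proj y)
  exact slowDeriv_eq_zero hy (fderiv_lift_eq_zero_of_nonneg h0 hy)

/-- **At most two cut-offs are active at any time** (property (iv): `supp ηᵢ ⊂ (tᵢ - τ/3, tᵢ₊₁ + τ/3)`,
an interval of length `5τ/3 < 2τ`): a nonnegative sequence bounded by `M` and vanishing at the
indices `i` with `ηᵢ(t, ·) ≡ 0` has sum at most `2M` over any finite set of indices.
[cite: BuckmasterEtAl2018, §5.2 (iv)] -/
theorem CutoffFamily.sum_le_two_mul {T τ c₀ : ℝ} {Cη : ℕ → ℕ → ℝ} (cut : CutoffFamily T τ c₀ Cη) (hτ : 0 < τ)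
    (t : ℝ) {g : ℕ → ℝ} {M : ℝ} (hM : 0 ≤ M) (hgM : ∀ i, g i ≤ M)
    (hzero : ∀ i, (∀ x, cut.η i t x = 0) → g i = 0) (s : Finset ℕ) :
    ∑ i ∈ s, g i ≤ 2 * M := by
  classical
  set A := s.filter (fun i => ∃ x, cut.η i t x ≠ 0) with hA
  have hsum : ∑ i ∈ A, g i = ∑ i ∈ s, g i := by
    refine Finset.sum_filter_of_ne fun i _ hne => ?_
    by_contra hno
    push Not at hno
    exact hne (hzero i hno)
  -- two active indices differ by at most one
  have hclose : ∀ i ∈ A, ∀ j ∈ A, i ≤ j + 1 := by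
    intro i hi j hj
    obtain ⟨x, hx⟩ := (Finset.mem_filter.1 hi).2
    obtain ⟨x', hx'⟩ := (Finset.mem_filter.1 hj).2
    have h1 := (cut.support i t x hx).1
    have h2 := (cut.support j t x' hx').2
    have h3 : (i : ℝ) * τ < ((j : ℝ) + 2) * τ := by nlinarith
    have h4 : (i : ℝ) < (j : ℝ) + 2 := lt_of_mul_lt_mul_right h3 hτ.le
    have h5 : i < j + 2 := by exact_mod_cast h4
    omega
  have hcard : A.card ≤ 2 := by
    by_contra hlt
    push Not at hlt
    obtain ⟨a, b, c, ha, hb, hc, hab, hac, hbc⟩ := Finset.two_lt_card_iff.1 hlt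
    have := hclose a ha b hb; have := hclose b hb a ha; have := hclose a ha c hc
    have := hclose c hc a ha; have := hclose b hb c hc; have := hclose c hc b hb
    omega
  rw [← hsum]
  calc ∑ i ∈ A, g i ≤ A.card • M := Finset.sum_le_card_nsmul _ _ _ fun i _ => hgM i
    _ = (A.card : ℝ) * M := by rw [nsmul_eq_mul]
    _ ≤ 2 * M := by
        refine mul_le_mul_of_nonneg_right ?_ hM
        exact_mod_cast hcard

end Counting

/-! ## The discharge of Cor. 5.8 (5.30) -/

section Discharge

/-- **BDSV Cor. 5.8, (5.30)** (the corrector bound): along the common prefix of the stage facts,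
`‖w_c‖₀ ≤ C δ_{q+1}^{1/2} ℓ⁻¹ λ_{q+1}⁻¹` and `[w_c]₁ ≤ C δ_{q+1}^{1/2} ℓ⁻¹` on `[0,T] × T³` for the
corrector `w_c = w_{q+1} - w_o` of the tree's construction. Proof: `w_c = n⁻¹∑ᵢ curl[slowPartᵢ]`
(`BDSV.correctorPart_proj`, the tree's (5.27)), the two-scale envelope of the slow parts
(`PerturbationData.hasEnvelope_slowPart`: amplitude `≲ δ_{q+1}^{1/2}ℓ⁻¹` from Lemma 5.4, (2.20),
App. B and the Mikado bounds on the stress ball; one derivative costs `≲ λ_{q+1}` by (6.6)), at most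
two active cut-offs, and `λ_{q+1} = 2πn_{q+1}`. Thresholds: `α < min(βb(b-1), (1-β)(b-1)/3)`, `N̄ = 2`,
`a` beyond the thresholds of `4δ_{q+2} ≤ δ_{q+1}λ_q^{-α}`, `C_inℓ^{2α} ≤ 1/2400`,
`8‖ofCols‖C_inλ_q^αℓ^α ≤ 1`, `8C_inλ_q^αℓ^α ≤ 1/100` and (6.6).
[cite: BuckmasterEtAl2018, Cor. 5.8 (arXiv (5.30))] -/
theorem correctorPartBound_holds : correctorPartBound := by
  intro 𝔚 c₀ hc₀ Cη β hβ hβ3 b hb hb'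
  have hb0 : 0 < b := by linarith
  have hb1 : 0 < b - 1 := by linarith
  have h1β : 0 < 1 - β := by linarith
  refine ⟨min (β * b * (b - 1)) ((1 - β) * (b - 1) / 3),
    lt_min (mul_pos (mul_pos hβ hb0) hb1) (div_pos (mul_pos h1β hb1) (by norm_num)), fun α hα hαlt => ?_⟩
  have hαb : α < 2 * β * b * (b - 1) := by
    have := lt_of_lt_of_le hαlt (min_le_left _ _); nlinarith [mul_pos hβ hb0]
  have hα66 : 3 * α < 2 * (1 - β) * (b - 1) := by
    have := lt_of_lt_of_le hαlt (min_le_right _ _); nlinarith [mul_pos h1β hb1]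
  refine ⟨2, fun Cin C₀ => ?_⟩
  set Cp : ℝ := max Cin 0 with hCp
  have hCp0 : 0 ≤ Cp := le_max_right _ _
  -- the Mikado bound on the stress ball
  obtain ⟨CV, hCV0, hCV⟩ := exists_forall_le_norm_iteratedFDeriv_mikadoLiftCL_le 𝔚.contDiff_mikadoLift_V
    (isCompact_closedBall (1 : 𝕃) (3 + 4 * ‖transposeCL‖)) 2
  -- thresholds in `a`
  obtain ⟨a₁, ha₁, h4⟩ := exists_threshold_four_amp hb hαb
  obtain ⟨a₂, ha₂, hu⟩ := exists_threshold_mollScale_rpow_le hβ.le hb.le hα Cp (by norm_num : (0 : ℝ) < 1 / 2400)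
  obtain ⟨a₃, ha₃, hstr⟩ := exists_threshold_freq_mul_mollScale_rpow_le hβ.le hb.le hα (8 * ‖ofColsCL‖ * Cp) one_pos
  obtain ⟨a₄, ha₄, hstr'⟩ :=
    exists_threshold_freq_mul_mollScale_rpow_le hβ.le hb.le hα (8 * Cp) (by norm_num : (0 : ℝ) < 1 / 100)
  obtain ⟨a₅, ha₅, h66⟩ := exists_threshold_mollScale_inv_mul_freq_inv_le_one hb.le hα66
  -- the constant
  set Acst : ℝ :=
    (‖transposeCL‖ * CV * (16 * (32 * ‖transposeCL‖) + 4 * 2 + 8 * max (Cη 0 2) 0) / Real.sqrt c₀) with hAcst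
  set Fcst : ℝ := (2 * Real.pi * (32 * ‖transposeCL‖ + 3) + max (Cη 0 2) 0 + 1) with hFcst
  have hA0 : 0 ≤ Acst := corrAmp_nonneg Cη c₀ hCV0
  have hF1 : 1 ≤ Fcst := one_le_corrFreq Cη
  have hF0 : 0 ≤ Fcst := zero_le_one.trans hF1
  have hcurl : 0 ≤ ‖curlCLM‖ := norm_nonneg _
  have hπ1 : 1 ≤ Real.pi := by linarith [Real.two_le_pi]
  have hπ0 : 0 ≤ Real.pi := zero_le_one.trans hπ1
  set K : ℝ := 4 * Real.pi * ‖curlCLM‖ * Acst * Fcst with hKdef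
  have hK₁ : 4 * Real.pi * ‖curlCLM‖ * Acst ≤ K := by
    rw [hKdef]
    exact le_mul_of_one_le_right (mul_nonneg (mul_nonneg (mul_nonneg (by norm_num) hπ0) hcurl) hA0) hF1
  have hK₂ : 4 * ‖curlCLM‖ * Acst * Fcst ≤ K := by
    rw [hKdef]
    have h0 : 0 ≤ 4 * ‖curlCLM‖ * Acst * Fcst := mul_nonneg (mul_nonneg (mul_nonneg (by norm_num) hcurl) hA0) hF0
    calc 4 * ‖curlCLM‖ * Acst * Fcst = 1 * (4 * ‖curlCLM‖ * Acst * Fcst) := (one_mul _).symm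
      _ ≤ Real.pi * (4 * ‖curlCLM‖ * Acst * Fcst) := mul_le_mul_of_nonneg_right hπ1 h0
      _ = 4 * Real.pi * ‖curlCLM‖ * Acst * Fcst := by ring
  refine ⟨K, max a₁ (max a₂ (max a₃ (max a₄ a₅))), lt_max_of_lt_left ha₁, fun a ha S H 𝒟 => ?_⟩
  have haa₁ : a₁ ≤ a := (le_max_left _ _).trans ha
  have haa₂ : a₂ ≤ a := ((le_max_left _ _).trans (le_max_right _ _)).trans ha
  have haa₃ : a₃ ≤ a := (((le_max_left _ _).trans (le_max_right _ _)).trans (le_max_right _ _)).trans ha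
  have haa₄ : a₄ ≤ a :=
    ((((le_max_left _ _).trans (le_max_right _ _)).trans (le_max_right _ _)).trans (le_max_right _ _)).trans ha
  have haa₅ : a₅ ≤ a :=
    ((((le_max_right _ _).trans (le_max_right _ _)).trans (le_max_right _ _)).trans (le_max_right _ _)).trans ha
  have ha1 : (1 : ℝ) ≤ a := ha₁.le.trans haa₁
  have ha0 : (0 : ℝ) < a := by linarith
  have H' : PerturbationHypotheses ⟨β, α, a, b⟩ S 2 Cp C₀ := H.mono_const ha1 (le_max_left _ _)
  -- the parameter inequalities at this `a`
  have h4' : 4 * amp β a b (S.q + 2) ≤ amp β a b (S.q + 1) * freq a b S.q ^ (-α) := h4 a haa₁ S.q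
  have hu' : Cp * mollScale β α a b S.q ^ (2 * α) ≤ 1 / 2400 := hu a haa₂ S.q
  have hstr₁ : 8 * ‖ofColsCL‖ * Cp * (freq a b S.q ^ α * mollScale β α a b S.q ^ α) ≤ 1 := hstr a haa₃ S.q
  have hstr₂ : 8 * (Cp * (freq a b S.q ^ α * mollScale β α a b S.q ^ α)) ≤ 1 / 100 := by
    have := hstr' a haa₄ S.q; linarith
  have h66' : (mollScale β α a b S.q)⁻¹ * (freq a b (S.q + 1))⁻¹ ≤ 1 := h66 a haa₅ S.q
  have hdef : Real.exp (4 * (Cp * mollScale β α a b S.q ^ (2 * α))) - 1 ≤ 1 / 300 := by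
    have hx0 : 0 ≤ 4 * (Cp * mollScale β α a b S.q ^ (2 * α)) :=
      mul_nonneg (by norm_num) (mul_nonneg hCp0 (Real.rpow_nonneg (mollScale_pos ha1 _).le _))
    have hx : |4 * (Cp * mollScale β α a b S.q ^ (2 * α))| ≤ 1 := by rw [abs_of_nonneg hx0]; linarith
    have h := Real.abs_exp_sub_one_le hx
    rw [abs_of_nonneg hx0] at h
    linarith [le_abs_self (Real.exp (4 * (Cp * mollScale β α a b S.q ^ (2 * α))) - 1)]
  -- scales
  set ℓ := mollScale β α a b S.q with hℓdef
  set n : ℝ := (Params.freqNat ⟨β, α, a, b⟩ (S.q + 1) : ℝ) with hndef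
  have hℓ : 0 < ℓ := mollScale_pos ha1 S.q
  have hn1 : 1 ≤ n := by
    rw [hndef]
    exact_mod_cast Nat.one_le_iff_ne_zero.2 (Nat.pos_iff_ne_zero.1 (Nat.ceil_pos.2 (Real.rpow_pos_of_pos ha0 _)))
  have hn0 : 0 < n := by linarith
  have hnne : Params.freqNat ⟨β, α, a, b⟩ (S.q + 1) ≠ 0 := by
    intro h; rw [hndef, h, Nat.cast_zero] at hn1; linarith
  have hfreq : freq a b (S.q + 1) = 2 * Real.pi * n := Params.freq_eq ⟨β, α, a, b⟩ ha0.le (S.q + 1)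
  have hninv : n⁻¹ = 2 * Real.pi * (freq a b (S.q + 1))⁻¹ := by
    rw [hfreq, mul_inv, mul_inv]; field_simp
  set E : ℝ := Acst * Real.sqrt (amp β a b (S.q + 1)) * ℓ⁻¹ with hEdef
  set ν : ℝ := 2 * (Fcst * n) with hνdef
  have hE0 : 0 ≤ E := mul_nonneg (mul_nonneg hA0 (Real.sqrt_nonneg _)) (inv_nonneg.2 hℓ.le)
  have hν0 : 0 ≤ ν := mul_nonneg (by norm_num) (mul_nonneg hF0 hn0.le)
  have hτ : 0 < Params.τ ⟨β, α, a, b⟩ S.q := glueScale_pos ha1 S.q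
  -- pointwise consequences at a time `t ∈ [0,T]`
  have main : ∀ t ∈ Icc 0 S.T, ∀ y : ℝ³,
      (∑ i ∈ Finset.range (cutoffCount S.T (Params.τ ⟨β, α, a, b⟩ S.q)),
          ‖slowPart ⟨β, α, a, b⟩ S 𝔚 𝒟.cut.η 𝒟.D i t y‖ ≤ 2 * E) ∧
      (∑ i ∈ Finset.range (cutoffCount S.T (Params.τ ⟨β, α, a, b⟩ S.q)),
          ‖fderiv ℝ (slowPart ⟨β, α, a, b⟩ S 𝔚 𝒟.cut.η 𝒟.D i t) y‖ ≤ 2 * (E * ν)) := by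
    intro t ht y
    -- per-index bounds
    have hind : ∀ i, ‖slowPart ⟨β, α, a, b⟩ S 𝔚 𝒟.cut.η 𝒟.D i t y‖ ≤ E ∧
        ‖fderiv ℝ (slowPart ⟨β, α, a, b⟩ S 𝔚 𝒟.cut.η 𝒟.D i t) y‖ ≤ E * ν := by
      intro i
      by_cases hact : ∃ x', 𝒟.cut.η i t x' ≠ 0
      · obtain ⟨x', hx'⟩ := hact
        have henv := 𝒟.hasEnvelope_slowPart H' 𝔚 le_rfl hc₀ hCp0 ha1 hb.le hβ.le hα.le h4' hu' hstr₁ h66'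
          hCV0 hCV ht hx'
        refine ⟨henv.norm_le₀ y, ?_⟩
        have h1 := henv.norm_le le_rfl y
        rwa [norm_iteratedFDeriv_one_eq_norm_fderiv, pow_one] at h1
      · push Not at hact
        have hz := slowPart_eq_zero_of_eta_eq_zero (P := ⟨β, α, a, b⟩) (S := S) (𝔚 := 𝔚) (D := 𝒟.D)
          (𝒟.cut.nonneg i t) hact
        rw [hz]
        simp only [fderiv_const_apply, norm_zero]
        exact ⟨hE0, mul_nonneg hE0 hν0⟩
    have hz0 : ∀ i, (∀ x, 𝒟.cut.η i t x = 0) → ‖slowPart ⟨β, α, a, b⟩ S 𝔚 𝒟.cut.η 𝒟.D i t y‖ = 0 :=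
      fun i hi => by
        rw [slowPart_eq_zero_of_eta_eq_zero (P := ⟨β, α, a, b⟩) (S := S) (𝔚 := 𝔚) (D := 𝒟.D)
          (𝒟.cut.nonneg i t) hi, norm_zero]
    have hz1 : ∀ i, (∀ x, 𝒟.cut.η i t x = 0) →
        ‖fderiv ℝ (slowPart ⟨β, α, a, b⟩ S 𝔚 𝒟.cut.η 𝒟.D i t) y‖ = 0 := fun i hi => by
      rw [slowPart_eq_zero_of_eta_eq_zero (P := ⟨β, α, a, b⟩) (S := S) (𝔚 := 𝔚) (D := 𝒟.D)
        (𝒟.cut.nonneg i t) hi]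
      simp only [fderiv_const_apply, norm_zero]
    exact ⟨𝒟.cut.sum_le_two_mul hτ t hE0 (fun i => (hind i).1) hz0 _,
      𝒟.cut.sum_le_two_mul hτ t (mul_nonneg hE0 hν0) (fun i => (hind i).2) hz1 _⟩
  -- hypotheses of the corrector identity at a time `t ∈ [0,T]`
  have hηs : ∀ t ∈ Icc 0 S.T, ∀ i, IsSmooth (𝒟.cut.η i t) := fun t ht i => (𝒟.cut.smooth i).isSmooth_slice ht
  have hRs : ∀ t ∈ Icc 0 S.T, IsSmooth (S.Rbar t) := fun t ht => H.eulerReynolds.smooth_stress.isSmooth_slice ht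
  have hDs : ∀ t ∈ Icc 0 S.T, ∀ i, IsSmooth (𝒟.D i t) := fun t ht i => (𝒟.flow i).smooth.isSmooth_slice ht
  have hball : ∀ t ∈ Icc 0 S.T, ∀ i x, 𝒟.cut.η i t x ≠ 0 →
      tildeR ⟨β, α, a, b⟩ S 𝒟.cut.η 𝒟.D i t x ∈ Metric.closedBall (1 : 𝕄) mikadoRadius := fun t ht i x hx =>
    𝒟.tildeR_mem_closedBall H' hCp0 ha1 hdef hstr₂ h4' ht hx x
  refine ⟨fun t ht x => ?_, fun j t ht x => ?_⟩
  · have h := norm_correctorPart_le_of_slowPart (𝔚 := 𝔚) (hηs t ht) (hRs t ht) (hDs t ht)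
      (H.eulerReynolds.symm t ht) hnne (hball t ht) (fun y => (main t ht y).1) x
    refine h.trans ?_
    have hX : 0 ≤ Real.sqrt (amp β a b (S.q + 1)) * ℓ⁻¹ * (freq a b (S.q + 1))⁻¹ :=
      mul_nonneg (mul_nonneg (Real.sqrt_nonneg _) (inv_nonneg.2 hℓ.le)) (inv_nonneg.2 (freq_pos ha1 _).le)
    calc (Params.freqNat ⟨β, α, a, b⟩ (S.q + 1) : ℝ)⁻¹ * (‖curlCLM‖ * (2 * E))
        = (4 * Real.pi * ‖curlCLM‖ * Acst) * (Real.sqrt (amp β a b (S.q + 1)) * ℓ⁻¹ * (freq a b (S.q + 1))⁻¹) := by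
          rw [← hndef, hninv, hEdef]; ring
      _ ≤ K * (Real.sqrt (amp β a b (S.q + 1)) * ℓ⁻¹ * (freq a b (S.q + 1))⁻¹) :=
          mul_le_mul_of_nonneg_right hK₁ hX
  · have h := norm_partialDeriv_correctorPart_le_of_slowPart (𝔚 := 𝔚) (hηs t ht) (hRs t ht) (hDs t ht)
      (H.eulerReynolds.symm t ht) hnne (hball t ht) (fun y => (main t ht y).2) j x
    refine h.trans ?_
    have hX : 0 ≤ Real.sqrt (amp β a b (S.q + 1)) * ℓ⁻¹ := mul_nonneg (Real.sqrt_nonneg _) (inv_nonneg.2 hℓ.le)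
    calc (Params.freqNat ⟨β, α, a, b⟩ (S.q + 1) : ℝ)⁻¹ * (‖curlCLM‖ * (2 * (E * ν)))
        = (n⁻¹ * n) * (4 * ‖curlCLM‖ * Acst * Fcst) * (Real.sqrt (amp β a b (S.q + 1)) * ℓ⁻¹) := by
          rw [← hndef, hEdef, hνdef]; ring
      _ = (4 * ‖curlCLM‖ * Acst * Fcst) * (Real.sqrt (amp β a b (S.q + 1)) * ℓ⁻¹) := by
          rw [inv_mul_cancel₀ hn0.ne', one_mul]
      _ ≤ K * (Real.sqrt (amp β a b (S.q + 1)) * ℓ⁻¹) := mul_le_mul_of_nonneg_right hK₂ hX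

end Discharge

end BDSV

end Literature.Analysis.FluidPDE
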